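import Summits.BirchSwinnertonDyer.BirchSwinnertonDyer.Theorems.TwoAdicConverseOrdLambdaHalfAtTwoBDPTwoVariableDefs
import Summits.BirchSwinnertonDyer.BirchSwinnertonDyer.Theorems.TwoAdicConverseBDPSelmerLowerDivisibilityAtTwoGaussContent
import Summits.BirchSwinnertonDyer.BirchSwinnertonDyer.Theorems.TwoAdicConverseBDPSelmerLowerDivisibilityAtTwoCharIdealPrincipal
import Summits.BirchSwinnertonDyer.BirchSwinnertonDyer.Theorems.TwoAdicConverseBDPSelmerLowerDivisibilityAtTwoFrameOfKatzSheet
import Summits.BirchSwinnertonDyer.BirchSwinnertonDyer.Theorems.TwoAdicConverseBDPSelmerLowerDivisibilityAtTwoPrimePinning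
import Summits.BirchSwinnertonDyer.BirchSwinnertonDyer.Theorems.TwoAdicConverseBDPSelmerLowerDivisibilityAtTwoTowerLineControl
import Summits.BirchSwinnertonDyer.BirchSwinnertonDyer.Theses.PrintCf2RubinValueTwo
import Literature.NumberTheory.FaltingsSerre.ParamodularCertificate
import Literature.NumberTheory.EllipticCurves.KellerYin2024.CharacterSelmerGroups
import HarnessLib

/-!
# Line `two_variable_gv_squeeze_two` — skeleton for O2 `BDPSelmerLowerDivisibilityAtTwo` (stmt-BirchSwinnertonDyer-24728)

Crux idea `two-variable-gv-squeeze-two` (Cruxes/BDPSelmerLowerDivisibilityAtTwo/Ideas/two-variable-gv-squeeze-two.md;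
crux-ideate seat 2, round 1, 2026-08-30).  Typed NODE (v1–v3): O2 ⟸ P0 ∧ S ∧ U ∧ R0T ∧ Rres.

**v7 (LEAD cruxlead-19556 g12, same session; pen RC-590/RC-591, director-bsd (556)(C)(i): the «split-prime line» SWAP of
crux-ideate seat 2 GEN 6 (`Lines/split_prime_line_finite_two.lean`, commit 75bfcda80282) ADOPTED.**  v6's research stub
FINLINE₂ `stub_lineFinite` — finite `2`-torsion of Greenberg's BDP-type Selmer group on EVERY in-frame `ℤ₂`-line, which the
node used only for the two PAIR-INDEPENDENT consequences «`X_Gr₂` is `Λ_K`-torsion» and «`red(toUnr₂ J C₀) ≠ 0`» (my own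
CAVEAT: over-strong by the exceptional lines) — is REPLACED by exactly those consequences, `TorsionResidueForallAt W K`, supplied
by seat 2's KERNEL seam `torsionResidueForall_of_splitLine` from THREE pieces on the ONE `ℤ₂`-line where GL(1) theory is in
print at `2`, the line `K_∞^{(v)} ⊂ K(v^∞)` RAMIFIED ONLY AT the relaxed prime `v`: P1 `SplitPrimeLineSelmerFiniteAt` (FIN-LINE on
that line only) ⟸ P4 `stub_trivialCharSplitLineFinite` (GL(1) PRINT leaf: the same BDP-type Selmer set for the TRIVIAL
character `ℚ₂/ℤ₂` over `K_∞^{(v)}` has finite `2`-torsion — Oukhaba–Viguié 2016 Thm 1.2 `μ = 0` for ALL `p`, Greenberg 1978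
torsion, Choi–Kezuka–Li 2019 `X_∞ = 0` for `ℚ(√−7)`; a stub until the typer vendors it, then an admissible named hypothesis like
the Katz sheet) ∧ P5 `stub_eisensteinDevissage` (kernel: on (β) `0 → 𝟙 → E[2] → 𝟙 → 0` bounds FIN-LINE by the trivial-character
set twice); P2 `stub_splitPrimePairExists` (CFT: that line extends to an adapted pair); P3 `stub_torsionResidueTransport`
(PAIR-TRANSPORT₂, tower-1 GEN 49 key: torsion and residual non-vanishing pass between adapted pairs of the same `K̃_∞`).
REGISTERED stubs v7 (the ONLY sorries) = {U `stub_upperInclusionRat`, R0G `stub_greenbergFunctionFree`, ACPIN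
`stub_acFibrePinning`, P2, P3, P4, P5} (7 ≤ 7); seat 2's decls are copied VERBATIM (§SPLIT); v6's FINLINE₂ survives as a
sorry-free STRONGER road (`torsionResidueForallAt_of_lineSelmerFinite`), no longer a stub.  ★ NODE v7:
`bdpSelmerLowerDivisibilityAtTwo_of_katzSheet_of_splitLine_of_acPin : thmII417 → U → R0G → P2 → P3 → P4 → P5 → ACPIN → O2`.

**v6 (LEAD cruxlead-19556 g12, 2026-08-30; pen RC-571 (k1), event (e1) = tower-1 GEN 47): the LINE OF RECORD re-cut after
the tower→line control theorem.**  The v5 research stub R0T `stub_frameTorsion` («an admissible Katz–Greenberg frame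
`(Ω, δ, Ωp, LK, G)` exists at `2` ∧ `X_Gr(E/K̃_∞)` is `Λ_K`-torsion») is SPLIT: its `LK`-slot is PRINT (de Shalit II.4.17,
`DeShalit1987.thmII417_exists_katzSheet`, carried BY NAME as the ledger's print leaf
`Theses.PrintCf2RubinValueTwo.KatzSheetTwoVariablePrint` = stmt-BirchSwinnertonDyer-24085), its `G`-slot is the research stub
R0G `stub_greenbergFunctionFree` (THE unprinted object at `2`), and its TORSION conjunct is now a THEOREM from ONE line:
`TwoAdicBDPTowerLineControl.xGr₂_baseChange_two_isTorsion_of_lineFinite` (tower-1 GEN 47, p769393) over COFGEN₂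
(`TwoAdicBDPCofiniteGeneration.moduleFinite_xGr₂_baseChange_two`, tower-1 GEN 46 p768155 — UNCONDITIONAL, no hypothesis)
and the tree's «`v̄` never splits completely in a `ℤ₂`-line of an imaginary quadratic field» (FD,
`ZpExtension.not_decomp_le_kerSubgroup_of_isImaginaryQuadratic`); the ONE line input is the new research stub FINLINE₂
`stub_lineFinite`: «Greenberg's Selmer group of `E[2^∞]` over the `κ₂`-LINE `K_∞^{(2)} = K̄^{ker κ₂}` (relaxed above `v`,
strict above `v̄`, unramified elsewhere) has finite `2`-torsion» (= its dual is `Λ`-torsion with `μ = 0`), VERBATIM the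
type of the door's `hline`, universally quantified over the frame's binders exactly as the node consumes it.  The `μ₂ = 0`
clause `red(toUnr₂ J C₀) ≠ 0` is the twin door `…_map_residue_toUnr₂_ne_zero_of_lineFinite` (consumed on the RresEq road).
CTRL₂ ∧ LINE₂ of v4.1/v5 DISAPPEAR (CTRL₂ verbatim for arbitrary pairs is heuristically FALSE on bad lines — tower-1
NOTE-CTRL2-GEN47 §1, evidence #35 on 24728 — and is itself a theorem under FD ∧ FINLINE₂: p769748
`ctrl₂_baseChange_two_of_lineFinite`); the v4 §LF annex (inner line) and the §CTRL annex are retired with them (they stay in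
the v5 mirror `Cruxes/OrdLambdaHalfAtTwo/Lines/kato_determinant_greenberg_two_O2_gv_squeeze_v4.lean` @9ee16cb2f246).
REGISTERED research stubs (the ONLY sorries of this file) = {U `stub_upperInclusionRat`, R0G `stub_greenbergFunctionFree`,
FINLINE₂ `stub_lineFinite`, ACPIN `stub_acFibrePinning`}; P0 / S / PIN / CONTENT / COFGEN₂ / TORSION / `μ₂ = 0` are KERNEL by
name.  ★ NODE v6: `bdpSelmerLowerDivisibilityAtTwo_of_katzSheet_of_lineFinite_of_acPin :
thmII417 → U → R0G → FINLINE₂ → ACPIN → O2` (PRINT binder displayed), twin `…_of_spanEq : thmII417 → U → R0G → FINLINE₂ →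
RresEq → O2`; COMPOSITION `BDPSelmerLowerDivisibilityAtTwo_of (hKatz : KatzSheetTwoVariablePrint) : BDPSelmerLowerDivisibilityAtTwo`
from the four stubs (the print is a registered obligation of the ledger, not a sorry of this file).  (k2) the sub-node
`greenbergAcFibrePinningAt_of_lineReading` / `acFibrePinningAtTwo_of_acLineReading`: ACPIN ⟸ ACLR♮ (N ∧ λ read through ONE
surjective residual line functional `φ : 𝔽̄₂⟦T₁,T₂⟧ → 𝔽̄₂⟦T⟧`, seat 2 g3/g4's seam in `order`-currency), PROVED, unregistered.
CAVEAT recorded (not hidden): FINLINE₂ as a `∀`-pairs statement asks torsion ∧ `μ = 0` on EVERY `ℤ₂`-line; the node needs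
them only for the TWO-VARIABLE module (pair-independent), so the `∀`-form is stronger by exactly the (finitely many, if any)
exceptional lines dividing `ch(X_Gr)` resp. `red ch(X_Gr)`; the weakening to «one line per `v̄`» needs a pair-transport
lemma for `XGr₂` (kernel task, not in the tree) — see the card §v6.
HONESTY: nothing here is proved about any curve; BSD is proved for no curve; O2 / 19556 / 19218 stay OPEN; typed ≠ proved.

History.  v5 (LEAD g11; pen RC-563 (B)(1)): Rres REPLACED by seat 1's ACPIN `stub_acFibrePinning` (crux idea
`anticyclotomic-fibre-pinning-two`: pin the cofactor at SOME prime `𝔓` of the special fibre `𝔽̄₂⟦T₁,T₂⟧` with (N)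
`red G ∉ 𝔓` and (Λ) `red C₁ ∈ 𝔓 + (red G)`); kernel PIN/CONTENT by name (p768124); `Rres ⇒ ACPIN` proved; stubs {U, R0T,
ACPIN}.  v4/v4.1 (LEAD g11): line of record re-cut to {U, R0T, Rres}; §LF/§KATZ/§CTRL annexes (tower-1 GEN 45/46, lead's
p767724/p767854).  v3 (seat 2 GEN 2): P0 `stub_charIdealPrincipal`, S `stub_gaussRigidity` KERNEL by name (p766476 /
p766427).  v2: R split into R0T ∧ Rres.  The crux decl is FIXED (imported from `…TwoAdicConverseOrdLambdaHalfAtTwoBDPTwoVariableDefs`),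
never restated here; hypothesis-taking roads conclude the LOCAL ALIAS `O2Goal` so that `BDPSelmerLowerDivisibilityAtTwo_of` is
the UNIQUE crux-headed theorem for the skeleton audit (the file audit lists those roads as `orphan` by construction).
-/

set_option linter.dupNamespace false
set_option autoImplicit false

noncomputable section

open scoped Classical NumberField
open WeierstrassCurve NumberField IsDedekindDomain Field CategoryTheory Function PowerSeries CongruenceSubgroup
open Literature.NumberTheory.EllipticCurves Literature.NumberTheory.EllipticCurves.Rank1Residual
open Literature.NumberTheory.EllipticCurves.ModularForms
open Literature.NumberTheory.GaloisRepresentations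
open Literature.NumberTheory.EllipticCurves.IwasawaAlgebra₂ Literature.NumberTheory.EllipticCurves.UnrSeries₂
open Literature.NumberTheory.EllipticCurves.YanZhu2026
open Literature.NumberTheory.EllipticCurves.GreenbergSelmer Literature.NumberTheory.EllipticCurves.GreenbergVatsal2000
open Literature.NumberTheory.EllipticCurves.Castella2018
open Summit.BirchSwinnertonDyer.BirchSwinnertonDyer.Theorems.TwoAdicKatoDeterminant
open Summit.BirchSwinnertonDyer.BirchSwinnertonDyer.Theorems.TwoAdicBDPTowerLineControl

namespace Summit.BirchSwinnertonDyer.BirchSwinnertonDyer.Cruxes.BDPSelmerLowerDivisibilityAtTwo.TwoVariableGvSqueezeTwo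

/-- The coefficient ring of the analytic side at `2`: `𝒪_{ℂ₂}⟦T₁,T₂⟧` (home of `G`, `LK`, and of `toUnr₂ 2 J C`). -/
abbrev A₂ : Type := PowerSeries (PowerSeries (PadicComplexInt 2))

/-- The RESIDUAL Iwasawa algebra `𝔽̄₂⟦T₁,T₂⟧` (`𝔽̄₂` = residue field of `𝒪_{ℂ₂}`): a 2-dimensional regular domain. -/
abbrev Ω₂ : Type := PowerSeries (PowerSeries (IsLocalRing.ResidueField (PadicComplexInt 2)))

/-- The residual LINE ring `𝔽̄₂⟦T⟧` (home of the one-line readings `φ (red₂ G)`; seat 2's `Ω₁`). -/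
abbrev Ω₁ : Type := PowerSeries (IsLocalRing.ResidueField (PadicComplexInt 2))

/-- Coefficientwise reduction `𝒪_{ℂ₂}⟦T₁,T₂⟧ → 𝔽̄₂⟦T₁,T₂⟧` (reduction modulo the maximal ideal of `𝒪_{ℂ₂}`, NOT modulo `2`). -/
def red₂ : A₂ →+* Ω₂ := PowerSeries.map (PowerSeries.map (IsLocalRing.residue (PadicComplexInt 2)))

/-- **O2 by name, as a LOCAL ALIAS** for the hypothesis-taking roads of this file (`… → O2Goal`), so that EXACTLY ONE theorem
(`BDPSelmerLowerDivisibilityAtTwo_of`) concludes the crux decl syntactically — the skeleton audit takes «the first» crux-headed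
theorem in environment order.  Unfolds (reducibly) to `BDPSelmerLowerDivisibilityAtTwo`; nothing asserted. -/
abbrev O2Goal : Prop := BDPSelmerLowerDivisibilityAtTwo

/-! ## §1 The pieces at a datum `(W, K)` — binder for binder the frame of `GreenbergLowerInclusionAt W K` -/

/-- **U at `(E,K)`** — the Euler-system-directional (UPPER) inclusion at `2` with `2`-power slack, for EVERY admissible
frame datum: `ch_{Λ_K}(X_Gr(E/K̃_∞))·𝒪_{ℂ₂}⟦T₁,T₂⟧ ∣ 2^m · G`. -/
def GreenbergUpperInclusionRatAt (W : WeierstrassCurve ℚ) [W.IsElliptic] [W.IsGloballyMinimal]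
    (K : Type) [Field K] [NumberField K] : Prop :=
  ∀ [IsCMField K] (ι : PadicAlgCl 2 ≃+* ℂ) (v vbar : HeightOneSpectrum (𝓞 K)) (κ₁ κ₂ : ZpExtension K 2)
    (γ₁ γ₂ : absoluteGaloisGroup K) [Fact (ZpExtension.IsTopGeneratorPair κ₁ κ₂ γ₁ γ₂)]
    [NeZero (W.conductorNorm ℤ)] (f : CuspForm (Gamma0 (W.conductorNorm ℤ)) 2),
    ModularForms.IsNewformOf W f → ∀ [NeZero (NumberField.discr K).natAbs],
    ((2 : ℕ) : 𝓞 K) ∈ v.asIdeal → ((2 : ℕ) : 𝓞 K) ∈ vbar.asIdeal → vbar ≠ v →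
    (∀ (w : InfinitePlace K) (k : 𝓞 K), k ∈ v.asIdeal ↔ ‖ι.symm (w.embedding (k : K))‖ < 1) →
    ∀ (Ω δ : ℂ) (Ωp : (unrIntegers 2)ˣ) (LK G : A₂),
      Ω ≠ 0 → (δ ^ 2 = (NumberField.discr K : ℂ) ∨ δ ^ 2 = -(NumberField.discr K : ℂ)) →
      IsKatzMeasure₂ ι v vbar ∅ κ₁ κ₂ γ₁⁻¹ γ₂⁻¹ 1 Ω δ ((Ωp : unrIntegers 2) : ℂ_[2]) LK →
      IsGreenbergLFunctionFree₂ ι v vbar κ₁ κ₂ γ₁⁻¹ γ₂⁻¹ f (NumberField.discr K).natAbs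
        (NumberField.classNumber K) LK G →
      ∀ J : ℤ_[2] →+* PadicComplexInt 2,
        (∀ x : ℤ_[2], ((J x : PadicComplexInt 2) : ℂ_[2]) = ((x : ℚ_[2]) : ℂ_[2])) →
        ∃ m : ℕ, Ideal.span {(2 : A₂) ^ m * G} ≤
          (WeierstrassCurve.XGr₂.charIdeal (W.baseChange K) 2 κ₁ κ₂ vbar γ₁ γ₂).map (toUnr₂ 2 J)

/-- **R at `(E,K)`** — the RESIDUAL (mod `𝔪_{𝒪_{ℂ₂}}`) two-variable equality at `2`: an admissible frame datum exists
with `X_Gr(E/K̃_∞)` `Λ_K`-torsion and, for every generator `C` of its characteristic ideal,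
`red(C) ≠ 0` (`μ = 0`) and `red(G)·𝔽̄₂⟦T₁,T₂⟧ = red(C)·𝔽̄₂⟦T₁,T₂⟧`.  (Derived from R0T ∧ Rres; v1–v3's stub.) -/
def GreenbergResidualEqualityAt (W : WeierstrassCurve ℚ) [W.IsElliptic] [W.IsGloballyMinimal]
    (K : Type) [Field K] [NumberField K] : Prop :=
  ∀ [IsCMField K] (ι : PadicAlgCl 2 ≃+* ℂ) (v vbar : HeightOneSpectrum (𝓞 K)) (κ₁ κ₂ : ZpExtension K 2)
    (γ₁ γ₂ : absoluteGaloisGroup K) [Fact (ZpExtension.IsTopGeneratorPair κ₁ κ₂ γ₁ γ₂)]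
    [NeZero (W.conductorNorm ℤ)] (f : CuspForm (Gamma0 (W.conductorNorm ℤ)) 2),
    ModularForms.IsNewformOf W f → ∀ [NeZero (NumberField.discr K).natAbs],
    ((2 : ℕ) : 𝓞 K) ∈ v.asIdeal → ((2 : ℕ) : 𝓞 K) ∈ vbar.asIdeal → vbar ≠ v →
    (∀ (w : InfinitePlace K) (k : 𝓞 K), k ∈ v.asIdeal ↔ ‖ι.symm (w.embedding (k : K))‖ < 1) →
    ∃ (Ω δ : ℂ) (Ωp : (unrIntegers 2)ˣ) (LK G : A₂),
      Ω ≠ 0 ∧ (δ ^ 2 = (NumberField.discr K : ℂ) ∨ δ ^ 2 = -(NumberField.discr K : ℂ)) ∧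
      IsKatzMeasure₂ ι v vbar ∅ κ₁ κ₂ γ₁⁻¹ γ₂⁻¹ 1 Ω δ ((Ωp : unrIntegers 2) : ℂ_[2]) LK ∧
      IsGreenbergLFunctionFree₂ ι v vbar κ₁ κ₂ γ₁⁻¹ γ₂⁻¹ f (NumberField.discr K).natAbs
        (NumberField.classNumber K) LK G ∧
      Module.IsTorsion (IwasawaAlgebra₂ 2) ((W.baseChange K).XGr₂ 2 κ₁ κ₂ vbar γ₁ γ₂) ∧
      ∀ J : ℤ_[2] →+* PadicComplexInt 2,
        (∀ x : ℤ_[2], ((J x : PadicComplexInt 2) : ℂ_[2]) = ((x : ℚ_[2]) : ℂ_[2])) →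
        ∀ C : IwasawaAlgebra₂ 2,
          WeierstrassCurve.XGr₂.charIdeal (W.baseChange K) 2 κ₁ κ₂ vbar γ₁ γ₂ = Ideal.span {C} →
          red₂ (toUnr₂ 2 J C) ≠ 0 ∧ Ideal.span {red₂ G} = Ideal.span {red₂ (toUnr₂ 2 J C)}

/-- **P0 at `(E,K)`** — principality of the two-variable characteristic ideal of a torsion `X_Gr(E/K̃_∞)` (pure algebra:
`ℤ₂⟦T₁,T₂⟧` is a UFD; kernel since tower-1 GEN 44). -/
def XGr₂CharIdealPrincipalAt (W : WeierstrassCurve ℚ) [W.IsElliptic] [W.IsGloballyMinimal]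
    (K : Type) [Field K] [NumberField K] : Prop :=
  ∀ (vbar : HeightOneSpectrum (𝓞 K)) (κ₁ κ₂ : ZpExtension K 2) (γ₁ γ₂ : absoluteGaloisGroup K)
    [Fact (ZpExtension.IsTopGeneratorPair κ₁ κ₂ γ₁ γ₂)],
    Module.IsTorsion (IwasawaAlgebra₂ 2) ((W.baseChange K).XGr₂ 2 κ₁ κ₂ vbar γ₁ γ₂) →
    ∃ C : IwasawaAlgebra₂ 2, WeierstrassCurve.XGr₂.charIdeal (W.baseChange K) 2 κ₁ κ₂ vbar γ₁ γ₂ = Ideal.span {C}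

/-- **S — Gauss rigidity over `𝒪_{ℂ₂}⟦T₁,T₂⟧`** (pure commutative algebra; the SEAM of the squeeze; kernel since tower-1
GEN 44): if `C ∣ 2^m·G`, `red(C) ≠ 0` and `red(G) ≐ red(C)`, then `G ∣ C`. -/
def GaussRigidity₂ : Prop :=
  ∀ (C G h : A₂) (m : ℕ), (2 : A₂) ^ m * G = C * h → red₂ C ≠ 0 →
    Ideal.span {red₂ G} = Ideal.span {red₂ C} → Ideal.span {C} ≤ Ideal.span {G}

/-- **R0T at `(E,K)`** — OBJECT half of R: an admissible frame datum `(Ω, δ, Ωp, LK, G)` exists at `2` (`LK` IS the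
Katz measure, `G` IS `𝓛_2^Gr(E/K)` in the coordinate-free frame) and `X_Gr(E/K̃_∞)` is `Λ_K`-torsion — O2's own
`∃`-frame plus its torsion conjunct.  v6/v7: NO LONGER a stub — DERIVED from PRINT{de Shalit II.4.17} ∧ R0G ∧ (TORSION ∧ RESIDUE)
(`greenbergFrameTorsionAt_of_frame_of_torsionResidue`; v6 road `…_of_lineSelmerFinite`; tower-1 GEN 46/47 by name). -/
def GreenbergFrameTorsionAt (W : WeierstrassCurve ℚ) [W.IsElliptic] [W.IsGloballyMinimal]
    (K : Type) [Field K] [NumberField K] : Prop :=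
  ∀ [IsCMField K] (ι : PadicAlgCl 2 ≃+* ℂ) (v vbar : HeightOneSpectrum (𝓞 K)) (κ₁ κ₂ : ZpExtension K 2)
    (γ₁ γ₂ : absoluteGaloisGroup K) [Fact (ZpExtension.IsTopGeneratorPair κ₁ κ₂ γ₁ γ₂)]
    [NeZero (W.conductorNorm ℤ)] (f : CuspForm (Gamma0 (W.conductorNorm ℤ)) 2),
    ModularForms.IsNewformOf W f → ∀ [NeZero (NumberField.discr K).natAbs],
    ((2 : ℕ) : 𝓞 K) ∈ v.asIdeal → ((2 : ℕ) : 𝓞 K) ∈ vbar.asIdeal → vbar ≠ v →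
    (∀ (w : InfinitePlace K) (k : 𝓞 K), k ∈ v.asIdeal ↔ ‖ι.symm (w.embedding (k : K))‖ < 1) →
    ∃ (Ω δ : ℂ) (Ωp : (unrIntegers 2)ˣ) (LK G : A₂),
      Ω ≠ 0 ∧ (δ ^ 2 = (NumberField.discr K : ℂ) ∨ δ ^ 2 = -(NumberField.discr K : ℂ)) ∧
      IsKatzMeasure₂ ι v vbar ∅ κ₁ κ₂ γ₁⁻¹ γ₂⁻¹ 1 Ω δ ((Ωp : unrIntegers 2) : ℂ_[2]) LK ∧
      IsGreenbergLFunctionFree₂ ι v vbar κ₁ κ₂ γ₁⁻¹ γ₂⁻¹ f (NumberField.discr K).natAbs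
        (NumberField.classNumber K) LK G ∧
      Module.IsTorsion (IwasawaAlgebra₂ 2) ((W.baseChange K).XGr₂ 2 κ₁ κ₂ vbar γ₁ γ₂)

/-- **Rres at `(E,K)`** — RESIDUAL half of R, for EVERY admissible frame datum (the `∀`-frame of U): `μ = 0` for
`ch(X_Gr)` read in `𝒪_{ℂ₂}⟦T₁,T₂⟧` and the residual divisor equality `(red G) = (red C)` in `𝔽̄₂⟦T₁,T₂⟧`. -/
def GreenbergResidualEqualityForallAt (W : WeierstrassCurve ℚ) [W.IsElliptic] [W.IsGloballyMinimal]
    (K : Type) [Field K] [NumberField K] : Prop :=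
  ∀ [IsCMField K] (ι : PadicAlgCl 2 ≃+* ℂ) (v vbar : HeightOneSpectrum (𝓞 K)) (κ₁ κ₂ : ZpExtension K 2)
    (γ₁ γ₂ : absoluteGaloisGroup K) [Fact (ZpExtension.IsTopGeneratorPair κ₁ κ₂ γ₁ γ₂)]
    [NeZero (W.conductorNorm ℤ)] (f : CuspForm (Gamma0 (W.conductorNorm ℤ)) 2),
    ModularForms.IsNewformOf W f → ∀ [NeZero (NumberField.discr K).natAbs],
    ((2 : ℕ) : 𝓞 K) ∈ v.asIdeal → ((2 : ℕ) : 𝓞 K) ∈ vbar.asIdeal → vbar ≠ v →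
    (∀ (w : InfinitePlace K) (k : 𝓞 K), k ∈ v.asIdeal ↔ ‖ι.symm (w.embedding (k : K))‖ < 1) →
    ∀ (Ω δ : ℂ) (Ωp : (unrIntegers 2)ˣ) (LK G : A₂),
      Ω ≠ 0 → (δ ^ 2 = (NumberField.discr K : ℂ) ∨ δ ^ 2 = -(NumberField.discr K : ℂ)) →
      IsKatzMeasure₂ ι v vbar ∅ κ₁ κ₂ γ₁⁻¹ γ₂⁻¹ 1 Ω δ ((Ωp : unrIntegers 2) : ℂ_[2]) LK →
      IsGreenbergLFunctionFree₂ ι v vbar κ₁ κ₂ γ₁⁻¹ γ₂⁻¹ f (NumberField.discr K).natAbs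
        (NumberField.classNumber K) LK G →
      ∀ J : ℤ_[2] →+* PadicComplexInt 2,
        (∀ x : ℤ_[2], ((J x : PadicComplexInt 2) : ℂ_[2]) = ((x : ℚ_[2]) : ℂ_[2])) →
        ∀ C : IwasawaAlgebra₂ 2,
          WeierstrassCurve.XGr₂.charIdeal (W.baseChange K) 2 κ₁ κ₂ vbar γ₁ γ₂ = Ideal.span {C} →
          red₂ (toUnr₂ 2 J C) ≠ 0 ∧ Ideal.span {red₂ G} = Ideal.span {red₂ (toUnr₂ 2 J C)}

/-- **R0F at `(E,K)`** — the pure OBJECT: an admissible Katz–Greenberg frame datum `(Ω, δ, Ωp, LK, G)` exists at `2` for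
every adapted pair (no Selmer clause).  `LK` PRINT (de Shalit II.4.17); `G` UNPRINTED at `2`. -/
def GreenbergFrameAt (W : WeierstrassCurve ℚ) [W.IsElliptic] [W.IsGloballyMinimal]
    (K : Type) [Field K] [NumberField K] : Prop :=
  ∀ [IsCMField K] (ι : PadicAlgCl 2 ≃+* ℂ) (v vbar : HeightOneSpectrum (𝓞 K)) (κ₁ κ₂ : ZpExtension K 2)
    (γ₁ γ₂ : absoluteGaloisGroup K) [Fact (ZpExtension.IsTopGeneratorPair κ₁ κ₂ γ₁ γ₂)]
    [NeZero (W.conductorNorm ℤ)] (f : CuspForm (Gamma0 (W.conductorNorm ℤ)) 2),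
    ModularForms.IsNewformOf W f → ∀ [NeZero (NumberField.discr K).natAbs],
    ((2 : ℕ) : 𝓞 K) ∈ v.asIdeal → ((2 : ℕ) : 𝓞 K) ∈ vbar.asIdeal → vbar ≠ v →
    (∀ (w : InfinitePlace K) (k : 𝓞 K), k ∈ v.asIdeal ↔ ‖ι.symm (w.embedding (k : K))‖ < 1) →
    ∃ (Ω δ : ℂ) (Ωp : (unrIntegers 2)ˣ) (LK G : A₂),
      Ω ≠ 0 ∧ (δ ^ 2 = (NumberField.discr K : ℂ) ∨ δ ^ 2 = -(NumberField.discr K : ℂ)) ∧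
      IsKatzMeasure₂ ι v vbar ∅ κ₁ κ₂ γ₁⁻¹ γ₂⁻¹ 1 Ω δ ((Ωp : unrIntegers 2) : ℂ_[2]) LK ∧
      IsGreenbergLFunctionFree₂ ι v vbar κ₁ κ₂ γ₁⁻¹ γ₂⁻¹ f (NumberField.discr K).natAbs
        (NumberField.classNumber K) LK G

/-- **R0G at `(E,K)`** — the two-variable Greenberg series RELATIVE to a Katz datum: for every embedding datum, adapted
pair and admissible Katz datum `(Ω, δ, Ωp, LK)`, some `G ∈ 𝒪_{ℂ₂}⟦T₁,T₂⟧` IS `𝓛_2^Gr(E/K)` in the coordinate-free frame.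
THE unprinted object at `2` (Castella–Hsieh / CGS / BSTW construct it for `p` odd; Kriz–Li at `2` is value-level). -/
def GreenbergObjectAt (W : WeierstrassCurve ℚ) [W.IsElliptic] [W.IsGloballyMinimal]
    (K : Type) [Field K] [NumberField K] : Prop :=
  ∀ [IsCMField K] (ι : PadicAlgCl 2 ≃+* ℂ) (v vbar : HeightOneSpectrum (𝓞 K)) (κ₁ κ₂ : ZpExtension K 2)
    (γ₁ γ₂ : absoluteGaloisGroup K) [Fact (ZpExtension.IsTopGeneratorPair κ₁ κ₂ γ₁ γ₂)]
    [NeZero (W.conductorNorm ℤ)] (f : CuspForm (Gamma0 (W.conductorNorm ℤ)) 2),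
    ModularForms.IsNewformOf W f → ∀ [NeZero (NumberField.discr K).natAbs],
    ((2 : ℕ) : 𝓞 K) ∈ v.asIdeal → ((2 : ℕ) : 𝓞 K) ∈ vbar.asIdeal → vbar ≠ v →
    (∀ (w : InfinitePlace K) (k : 𝓞 K), k ∈ v.asIdeal ↔ ‖ι.symm (w.embedding (k : K))‖ < 1) →
    ∀ (Ω δ : ℂ) (Ωp : (unrIntegers 2)ˣ) (LK : A₂),
      Ω ≠ 0 → (δ ^ 2 = (NumberField.discr K : ℂ) ∨ δ ^ 2 = -(NumberField.discr K : ℂ)) →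
      IsKatzMeasure₂ ι v vbar ∅ κ₁ κ₂ γ₁⁻¹ γ₂⁻¹ 1 Ω δ ((Ωp : unrIntegers 2) : ℂ_[2]) LK →
      ∃ G : A₂, IsGreenbergLFunctionFree₂ ι v vbar κ₁ κ₂ γ₁⁻¹ γ₂⁻¹ f (NumberField.discr K).natAbs
        (NumberField.classNumber K) LK G

/-- **FINLINE₂ at `(E,K)`** (v6; the ONE line input of tower-1 GEN 47, VERBATIM the type of `hline` in
`TwoAdicBDPTowerLineControl.xGr₂_baseChange_two_isTorsion_of_lineFinite`) — for the split primes `v ≠ v̄` over `2` and every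
adapted pair `(κ₁, κ₂; γ₁, γ₂)`: Greenberg's Selmer group of `E[2^∞]` over the `κ₂`-LINE `K_∞^{(2)} = K̄^{ker κ₂}` with
Castella's BDP data at `v̄` (STRICT above `v̄`, RELAXED above `v`, unramified away from `2`; `Σ = ∅`) has FINITE `2`-torsion —
equivalently its Pontryagin dual is `Λ`-torsion with `μ = 0`.  For `κ₂` anticyclotomic this is the BDP/Greenberg
anticyclotomic Selmer group at `2` (print siblings `p` odd: cotorsion by Castella/BCK, `μ = 0` by Hsieh/Burungale).
STRONGER than the node needs by the exceptional lines (those `ℤ₂`-lines whose linear form divides `ch(X_Gr)` or its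
reduction; finitely many if any) — see the module docstring's CAVEAT. -/
def XGr₂LineSelmerFiniteAt (W : WeierstrassCurve ℚ) [W.IsElliptic] [W.IsGloballyMinimal]
    (K : Type) [Field K] [NumberField K] : Prop :=
  ∀ (v vbar : HeightOneSpectrum (𝓞 K)) (κ₁ κ₂ : ZpExtension K 2) (γ₁ γ₂ : absoluteGaloisGroup K)
    [Fact (ZpExtension.IsTopGeneratorPair κ₁ κ₂ γ₁ γ₂)],
    ((2 : ℕ) : 𝓞 K) ∈ v.asIdeal → ((2 : ℕ) : 𝓞 K) ∈ vbar.asIdeal → vbar ≠ v →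
    Set.Finite {t : (W.baseChange K).subgroupH1 2 κ₂.kerSubgroup |
      t ∈ GreenbergVatsal2000.datumSelmerInfty κ₂ ((W.baseChange K).geomPrimaryTorsion 2)
            (Castella2018.AcSelmer.bdpData ((W.baseChange K).geomPrimaryTorsion 2) 2 vbar) ∅ ∧ 2 • t = 0}

/-- **COFGEN₂ at `(E,K)`** — `X_Gr(E/K̃_∞)` is finitely generated over `Λ_K = Λ₂` (a THEOREM since tower-1 GEN 46:
`xGr₂Cofg_holds` below; kept as a named piece for the card). -/
def XGr₂CofgAt (W : WeierstrassCurve ℚ) [W.IsElliptic] [W.IsGloballyMinimal]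
    (K : Type) [Field K] [NumberField K] : Prop :=
  ∀ (v vbar : HeightOneSpectrum (𝓞 K)) (κ₁ κ₂ : ZpExtension K 2) (γ₁ γ₂ : absoluteGaloisGroup K)
    [Fact (ZpExtension.IsTopGeneratorPair κ₁ κ₂ γ₁ γ₂)],
    ((2 : ℕ) : 𝓞 K) ∈ v.asIdeal → ((2 : ℕ) : 𝓞 K) ∈ vbar.asIdeal → vbar ≠ v →
    Module.Finite (IwasawaAlgebra₂ 2) ((W.baseChange K).XGr₂ 2 κ₁ κ₂ vbar γ₁ γ₂)

/-! ### §SPLIT (v7; crux-ideate seat 2 GEN 6 `Lines/split_prime_line_finite_two.lean` @75bfcda80282, decls VERBATIM):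
what the node consumes per pair, the v-RAMIFIED line, pair transport, the GL(1) print leaf and the Eisenstein dévissage -/

/-- `κ` is RAMIFIED ONLY INSIDE `S`: every inertia group of `Γ_K` at a finite place outside `S` lies in `ker κ`
(for `S = {v}`, `K` imaginary quadratic, `2 = v v̄`: `K̄^{ker κ}` is the ℤ₂-extension `K_∞^{(v)} ⊂ K(v^∞)`). (seat 2, verbatim) -/
def RamifiedOnlyIn {K : Type} [Field K] [NumberField K] {p : ℕ} [Fact p.Prime] (κ : ZpExtension K p)
    (S : Set (HeightOneSpectrum (𝓞 K))) : Prop :=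
  Literature.NumberTheory.FaltingsSerre.inertiaOutside K S ⊆
    ((κ.kerSubgroup : Subgroup (Field.absoluteGaloisGroup K)) : Set (Field.absoluteGaloisGroup K))

/-- FIN-LINE(κ₂; v̄) — VERBATIM the v6 stub's datum (the type of the door's `hline`): the 2-torsion of Greenberg's Selmer
group of `E[2^∞]` over `K̄^{ker κ₂}`, strict above `v̄`, relaxed at the other prime above 2, `S₀ = ∅`, is finite.
Depends on `(κ₂, v̄)` only. (seat 2, verbatim) -/
def LineSelmerTwoTorsionFinite (W : WeierstrassCurve ℚ) [W.IsElliptic] (K : Type) [Field K] [NumberField K]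
    (κ₂ : ZpExtension K 2) (vbar : HeightOneSpectrum (𝓞 K)) : Prop :=
  Set.Finite {t : (W.baseChange K).subgroupH1 2 κ₂.kerSubgroup |
    t ∈ datumSelmerInfty κ₂ ((W.baseChange K).geomPrimaryTorsion 2)
      (AcSelmer.bdpData ((W.baseChange K).geomPrimaryTorsion 2) 2 vbar) ∅ ∧ 2 • t = 0}

/-- **P1 FIN-SPLIT** (reduced to PRINT P4 ∧ kernel P5 below): FIN-LINE at every line `κ₂` ramified only at the relaxed
prime `v`. (seat 2, verbatim) -/
def SplitPrimeLineSelmerFiniteAt (W : WeierstrassCurve ℚ) [W.IsElliptic] (K : Type) [Field K] [NumberField K] :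
    Prop :=
  IsImaginaryQuadratic K → ∀ (v vbar : HeightOneSpectrum (𝓞 K)) (κ₂ : ZpExtension K 2), ((2 : ℕ) : 𝓞 K) ∈ v.asIdeal →
    ((2 : ℕ) : 𝓞 K) ∈ vbar.asIdeal → vbar ≠ v → RamifiedOnlyIn κ₂ {v} → LineSelmerTwoTorsionFinite W K κ₂ vbar

/-- **P2 SPLIT-PAIR-EXISTS** (ATTACKABLE, GL(1)/CFT): for `2 = v v̄` split in `K` there is an adapted pair
`(κ₁, κ₂; γ₁, γ₂)` whose second line is ramified only at `v` (the ℤ₂-quotient of `Gal(K(v^∞)/K)`, a PRIMITIVE element of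
`Hom(Gal(K̃_∞/K), ℤ₂)`, extended to a basis — `κ₁` need not be `κ_{v̄}`). (seat 2, verbatim) -/
def SplitPrimePairExistsAt (K : Type) [Field K] [NumberField K] : Prop :=
  IsImaginaryQuadratic K → ∀ (v vbar : HeightOneSpectrum (𝓞 K)), ((2 : ℕ) : 𝓞 K) ∈ v.asIdeal → ((2 : ℕ) : 𝓞 K) ∈ vbar.asIdeal → vbar ≠ v →
    ∃ (κ₁ κ₂ : ZpExtension K 2) (γ₁ γ₂ : Field.absoluteGaloisGroup K),
      ZpExtension.IsTopGeneratorPair κ₁ κ₂ γ₁ γ₂ ∧ RamifiedOnlyIn κ₂ {v}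

/-- The residual non-vanishing of a generator `C₀` of `ch_{Λ_K}(X_Gr₂)` along `J : ℤ₂ → 𝒪_{ℂ₂}` (the `μ₂ = 0` clause; `= red₂ (toUnr₂ 2 J C₀) ≠ 0`
by `rfl`). (seat 2, verbatim) -/
def ResidueNonvanishing (J : ℤ_[2] →+* PadicComplexInt 2) (C₀ : IwasawaAlgebra₂ 2) : Prop :=
  PowerSeries.map (PowerSeries.map (IsLocalRing.residue (PadicComplexInt 2))) (IwasawaAlgebra₂.toUnr₂ 2 J C₀) ≠ 0

/-- **TORSION ∧ RESIDUE at every adapted pair** — exactly the two consequences the v6 node drew from `stub_lineFinite`; the v7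
node consumes THIS. (seat 2, verbatim) -/
def TorsionResidueForallAt (W : WeierstrassCurve ℚ) [W.IsElliptic] (K : Type) [Field K] [NumberField K] : Prop :=
  IsImaginaryQuadratic K → ∀ (v vbar : HeightOneSpectrum (𝓞 K)), ((2 : ℕ) : 𝓞 K) ∈ v.asIdeal → ((2 : ℕ) : 𝓞 K) ∈ vbar.asIdeal → vbar ≠ v →
    ∀ (κ₁ κ₂ : ZpExtension K 2) (γ₁ γ₂ : Field.absoluteGaloisGroup K)
      [Fact (ZpExtension.IsTopGeneratorPair κ₁ κ₂ γ₁ γ₂)],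
      Module.IsTorsion (IwasawaAlgebra₂ 2) ((W.baseChange K).XGr₂ 2 κ₁ κ₂ vbar γ₁ γ₂) ∧
        ∀ (J : ℤ_[2] →+* PadicComplexInt 2) (C₀ : IwasawaAlgebra₂ 2),
          WeierstrassCurve.XGr₂.charIdeal (W.baseChange K) 2 κ₁ κ₂ vbar γ₁ γ₂ = Ideal.span {C₀} →
            ResidueNonvanishing J C₀

/-- **P3 PAIR-TRANSPORT₂** (ATTACKABLE kernel; the lead's W1, tower-1 GEN 49 key): torsion of `X_Gr₂` and residual non-vanishing
of its characteristic generators pass from one adapted pair `(κ₁', κ₂'; γ₁', γ₂')` to any other `(κ₁, κ₂; γ₁, γ₂)` at the same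
strict prime `v̄` (same underlying `ℤ₂⟦Gal(K̃_∞/K)⟧`-module; only the `Λ_K`-coordinates change). (seat 2, verbatim) -/
def TorsionResidueTransportAt (W : WeierstrassCurve ℚ) [W.IsElliptic] (K : Type) [Field K] [NumberField K] : Prop :=
  IsImaginaryQuadratic K → ∀ (vbar : HeightOneSpectrum (𝓞 K)), ((2 : ℕ) : 𝓞 K) ∈ vbar.asIdeal →
    ∀ (κ₁ κ₂ κ₁' κ₂' : ZpExtension K 2) (γ₁ γ₂ γ₁' γ₂' : Field.absoluteGaloisGroup K)
      [Fact (ZpExtension.IsTopGeneratorPair κ₁ κ₂ γ₁ γ₂)] [Fact (ZpExtension.IsTopGeneratorPair κ₁' κ₂' γ₁' γ₂')],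
      (Module.IsTorsion (IwasawaAlgebra₂ 2) ((W.baseChange K).XGr₂ 2 κ₁' κ₂' vbar γ₁' γ₂') →
          Module.IsTorsion (IwasawaAlgebra₂ 2) ((W.baseChange K).XGr₂ 2 κ₁ κ₂ vbar γ₁ γ₂)) ∧
        ((∀ (J : ℤ_[2] →+* PadicComplexInt 2) (C₀ : IwasawaAlgebra₂ 2),
            WeierstrassCurve.XGr₂.charIdeal (W.baseChange K) 2 κ₁' κ₂' vbar γ₁' γ₂' = Ideal.span {C₀} →
              ResidueNonvanishing J C₀) →
          ∀ (J : ℤ_[2] →+* PadicComplexInt 2) (C₀ : IwasawaAlgebra₂ 2),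
            WeierstrassCurve.XGr₂.charIdeal (W.baseChange K) 2 κ₁ κ₂ vbar γ₁ γ₂ = Ideal.span {C₀} →
              ResidueNonvanishing J C₀)

/-- The TRIVIAL GL₁ character module `ℚ₂/ℤ₂` of `Γ_K`, as the Keller–Yin carrier `(F/𝒪)(θ)` at `θ = 1`, `S = ∅`. (seat 2, verbatim) -/
abbrev TrivCharModule (K : Type) [Field K] [NumberField K] : Type :=
  KellerYin2024.charModule (∅ : Set (PadicAlgCl 2))
    (1 : FramedGaloisRep K (padicCoeffIntegers (∅ : Set (PadicAlgCl 2))) 1)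

/-- **P4 GL1-FIN** (PRINT + elementary): over every line `κ` ramified only at `v`, the BDP-type Selmer set of the trivial
character (strict = locally split above `v̄`, relaxed above `v`, relaxed at a finite `S₀`) has finite 2-torsion —
`Hom(𝔛, ℚ₂/ℤ₂)[2]` for a quotient `𝔛` of `Gal(M^{S₀ ∪ {v}}_∞/K_∞^{(v)})`, finitely generated over `ℤ₂` by Oukhaba–Viguié 2016
Thm 1.2 (µ = 0, all `p`) + Greenberg 1978 (Λ-torsion) + pro-2 tame inertia at the finitely many places above `S₀` (every
`𝔮 ∤ v` is finitely decomposed in `K_∞^{(v)}`). [cite: arXiv:1311.3565, Thm 1.2] (seat 2, verbatim) -/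
def TrivialCharSplitLineFiniteAt (K : Type) [Field K] [NumberField K] : Prop :=
  IsImaginaryQuadratic K → ∀ (v vbar : HeightOneSpectrum (𝓞 K)) (κ : ZpExtension K 2) (S₀ : Set (HeightOneSpectrum (𝓞 K))), S₀.Finite →
    ((2 : ℕ) : 𝓞 K) ∈ v.asIdeal → ((2 : ℕ) : 𝓞 K) ∈ vbar.asIdeal → vbar ≠ v → RamifiedOnlyIn κ {v} →
    Set.Finite {t : subgroupH1 κ.kerSubgroup (TrivCharModule K) |
      t ∈ datumSelmerInfty κ (TrivCharModule K) (AcSelmer.bdpData (TrivCharModule K) 2 vbar) S₀ ∧ 2 • t = 0}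

/-- **P5 DEV** (ATTACKABLE kernel Galois cohomology): on habitat (β) — `E[2]` reducible, i.e. a rational point of order 2, so
`0 → 𝟙 → E[2] → 𝟙 → 0` over `ℚ` — GL1-FIN bounds FIN-LINE on every v-ramified line (take `S₀` = the bad places; the
conditions above 2 are relaxed/strict, hence curve-independent; kernel bricks: the long exact sequence, `E(K_∞^{(v)})[2^∞]`
finite, finitely many places above `v̄` and `S₀` on the line, and `finite_of_finite_image_of_finite_inter_ker`). (seat 2, verbatim) -/
def EisensteinDevissageAt (W : WeierstrassCurve ℚ) [W.IsElliptic] (K : Type) [Field K] [NumberField K] : Prop :=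
  ¬ W.HasIrreducibleModPGaloisRep 2 → TrivialCharSplitLineFiniteAt K → SplitPrimeLineSelmerFiniteAt W K

/-- **RresEq at `(E,K)`** — the residual SPAN EQUALITY alone, for every admissible frame datum, every `J`, every
generator `C`: `(red₂ G) = (red₂ (toUnr₂ 2 J C))` in `𝔽̄₂⟦T₁,T₂⟧` (content R_alg ∧ R_KMC ∧ R_an; the `μ = 0` conjunct of
Rres is supplied by the torsion/residue input).  The alternative (stronger) residual leaf to ACPIN; kept as a sorry-free road. -/
def GreenbergResidualSpanEqForallAt (W : WeierstrassCurve ℚ) [W.IsElliptic] [W.IsGloballyMinimal]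
    (K : Type) [Field K] [NumberField K] : Prop :=
  ∀ [IsCMField K] (ι : PadicAlgCl 2 ≃+* ℂ) (v vbar : HeightOneSpectrum (𝓞 K)) (κ₁ κ₂ : ZpExtension K 2)
    (γ₁ γ₂ : absoluteGaloisGroup K) [Fact (ZpExtension.IsTopGeneratorPair κ₁ κ₂ γ₁ γ₂)]
    [NeZero (W.conductorNorm ℤ)] (f : CuspForm (Gamma0 (W.conductorNorm ℤ)) 2),
    ModularForms.IsNewformOf W f → ∀ [NeZero (NumberField.discr K).natAbs],
    ((2 : ℕ) : 𝓞 K) ∈ v.asIdeal → ((2 : ℕ) : 𝓞 K) ∈ vbar.asIdeal → vbar ≠ v →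
    (∀ (w : InfinitePlace K) (k : 𝓞 K), k ∈ v.asIdeal ↔ ‖ι.symm (w.embedding (k : K))‖ < 1) →
    ∀ (Ω δ : ℂ) (Ωp : (unrIntegers 2)ˣ) (LK G : A₂),
      Ω ≠ 0 → (δ ^ 2 = (NumberField.discr K : ℂ) ∨ δ ^ 2 = -(NumberField.discr K : ℂ)) →
      IsKatzMeasure₂ ι v vbar ∅ κ₁ κ₂ γ₁⁻¹ γ₂⁻¹ 1 Ω δ ((Ωp : unrIntegers 2) : ℂ_[2]) LK →
      IsGreenbergLFunctionFree₂ ι v vbar κ₁ κ₂ γ₁⁻¹ γ₂⁻¹ f (NumberField.discr K).natAbs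
        (NumberField.classNumber K) LK G →
      ∀ J : ℤ_[2] →+* PadicComplexInt 2,
        (∀ x : ℤ_[2], ((J x : PadicComplexInt 2) : ℂ_[2]) = ((x : ℚ_[2]) : ℂ_[2])) →
        ∀ C : IwasawaAlgebra₂ 2,
          WeierstrassCurve.XGr₂.charIdeal (W.baseChange K) 2 κ₁ κ₂ vbar γ₁ γ₂ = Ideal.span {C} →
          Ideal.span {red₂ G} = Ideal.span {red₂ (toUnr₂ 2 J C)}

/-! ## §2 The pieces on the habitat of O2 -/

/-- U on the habitat (β): two-variable Euler-system divisibility at `2` up to powers of `2`. Research grade. -/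
def TwoVariableUpperInclusionRatAtTwo : Prop :=
  ∀ (W : WeierstrassCurve ℚ) [W.IsElliptic] [W.IsGloballyMinimal],
    ¬ W.HasCM → GoodOrd W 2 → ¬ W.HasIrreducibleModPGaloisRep 2 →
    ∀ (K : Type) [Field K] [NumberField K],
      (IsImaginaryQuadratic K ∧ SatisfiesHeegnerHypothesis (2 * W.conductorNorm ℤ) K) →
      GreenbergUpperInclusionRatAt W K

/-- R on the habitat (β): the residual two-variable Greenberg–Vatsal equality at `2` (derived from R0T ∧ Rres). -/
def TwoVariableResidualEqualityAtTwo : Prop :=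
  ∀ (W : WeierstrassCurve ℚ) [W.IsElliptic] [W.IsGloballyMinimal],
    ¬ W.HasCM → GoodOrd W 2 → ¬ W.HasIrreducibleModPGaloisRep 2 →
    ∀ (K : Type) [Field K] [NumberField K],
      (IsImaginaryQuadratic K ∧ SatisfiesHeegnerHypothesis (2 * W.conductorNorm ℤ) K) →
      GreenbergResidualEqualityAt W K

/-- P0 on the habitat. Kernel algebra. -/
def XGr₂CharIdealPrincipalAtTwo : Prop :=
  ∀ (W : WeierstrassCurve ℚ) [W.IsElliptic] [W.IsGloballyMinimal] (K : Type) [Field K] [NumberField K],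
    XGr₂CharIdealPrincipalAt W K

/-- R0T on the habitat (β): the OBJECT half of R (v6: DERIVED, `frameTorsion_of_katzSheet_of_object_of_lineFinite`). -/
def TwoVariableFrameTorsionAtTwo : Prop :=
  ∀ (W : WeierstrassCurve ℚ) [W.IsElliptic] [W.IsGloballyMinimal],
    ¬ W.HasCM → GoodOrd W 2 → ¬ W.HasIrreducibleModPGaloisRep 2 →
    ∀ (K : Type) [Field K] [NumberField K],
      (IsImaginaryQuadratic K ∧ SatisfiesHeegnerHypothesis (2 * W.conductorNorm ℤ) K) →
      GreenbergFrameTorsionAt W K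

/-- Rres on the habitat (β): the RESIDUAL half of R (the v4.1 leaf; implies ACPIN). -/
def TwoVariableResidualEqualityForallAtTwo : Prop :=
  ∀ (W : WeierstrassCurve ℚ) [W.IsElliptic] [W.IsGloballyMinimal],
    ¬ W.HasCM → GoodOrd W 2 → ¬ W.HasIrreducibleModPGaloisRep 2 →
    ∀ (K : Type) [Field K] [NumberField K],
      (IsImaginaryQuadratic K ∧ SatisfiesHeegnerHypothesis (2 * W.conductorNorm ℤ) K) →
      GreenbergResidualEqualityForallAt W K

/-- R0F on the habitat (β): the frame OBJECT at 2 (⟸ PRINT{thmII417} ∧ R0G, §KATZ). -/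
def TwoVariableFrameAtTwo : Prop :=
  ∀ (W : WeierstrassCurve ℚ) [W.IsElliptic] [W.IsGloballyMinimal],
    ¬ W.HasCM → GoodOrd W 2 → ¬ W.HasIrreducibleModPGaloisRep 2 →
    ∀ (K : Type) [Field K] [NumberField K],
      (IsImaginaryQuadratic K ∧ SatisfiesHeegnerHypothesis (2 * W.conductorNorm ℤ) K) →
      GreenbergFrameAt W K

/-- R0G on the habitat (β): the two-variable Greenberg series at `2` relative to every Katz datum.  Research (UNPRINTED). -/
def TwoVariableGreenbergObjectAtTwo : Prop :=
  ∀ (W : WeierstrassCurve ℚ) [W.IsElliptic] [W.IsGloballyMinimal],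
    ¬ W.HasCM → GoodOrd W 2 → ¬ W.HasIrreducibleModPGaloisRep 2 →
    ∀ (K : Type) [Field K] [NumberField K],
      (IsImaginaryQuadratic K ∧ SatisfiesHeegnerHypothesis (2 * W.conductorNorm ℤ) K) →
      GreenbergObjectAt W K

/-- FINLINE₂ on the habitat (β) (v6's stub; v7: a STRONGER sorry-free input, no longer registered): finite `2`-torsion of
Greenberg's BDP-type Selmer group over every in-frame `ℤ₂`-line.  Research at `2` (print siblings `p` odd). -/
def TwoVariableLineSelmerFiniteAtTwo : Prop :=
  ∀ (W : WeierstrassCurve ℚ) [W.IsElliptic] [W.IsGloballyMinimal],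
    ¬ W.HasCM → GoodOrd W 2 → ¬ W.HasIrreducibleModPGaloisRep 2 →
    ∀ (K : Type) [Field K] [NumberField K],
      (IsImaginaryQuadratic K ∧ SatisfiesHeegnerHypothesis (2 * W.conductorNorm ℤ) K) →
      XGr₂LineSelmerFiniteAt W K

/-- TORSION ∧ RESIDUE on the habitat (β) (v7: what the node consumes; DERIVED from P2 ∧ P3 ∧ P4 ∧ P5, or from FINLINE₂). -/
def TwoVariableTorsionResidueAtTwo : Prop :=
  ∀ (W : WeierstrassCurve ℚ) [W.IsElliptic] [W.IsGloballyMinimal],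
    ¬ W.HasCM → GoodOrd W 2 → ¬ W.HasIrreducibleModPGaloisRep 2 →
    ∀ (K : Type) [Field K] [NumberField K],
      (IsImaginaryQuadratic K ∧ SatisfiesHeegnerHypothesis (2 * W.conductorNorm ℤ) K) →
      TorsionResidueForallAt W K

/-- P2 SPLIT-PAIR-EXISTS for every number field (guarded inside by `IsImaginaryQuadratic K`; CFT, ATTACKABLE). -/
def SplitPrimePairExistsAtTwo : Prop :=
  ∀ (K : Type) [Field K] [NumberField K], SplitPrimePairExistsAt K

/-- P3 PAIR-TRANSPORT₂ for every elliptic `W/ℚ` and number field `K` (kernel, ATTACKABLE; tower-1 GEN 49 key). -/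
def TorsionResidueTransportAtTwo : Prop :=
  ∀ (W : WeierstrassCurve ℚ) [W.IsElliptic] (K : Type) [Field K] [NumberField K], TorsionResidueTransportAt W K

/-- P4 GL1-FIN for every number field (guarded inside by `IsImaginaryQuadratic K`; GL(1) PRINT leaf at `p = 2`). -/
def TrivialCharSplitLineFiniteAtTwo : Prop :=
  ∀ (K : Type) [Field K] [NumberField K], TrivialCharSplitLineFiniteAt K

/-- P5 DEV for every elliptic `W/ℚ` and number field `K` (kernel, ATTACKABLE; `¬ Irr E[2]` is a hypothesis inside). -/
def EisensteinDevissageAtTwo : Prop :=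
  ∀ (W : WeierstrassCurve ℚ) [W.IsElliptic] (K : Type) [Field K] [NumberField K], EisensteinDevissageAt W K

/-- COFGEN₂ on the habitat (β) (a THEOREM: `twoVariableCofgAtTwo_holds`). -/
def TwoVariableCofgAtTwo : Prop :=
  ∀ (W : WeierstrassCurve ℚ) [W.IsElliptic] [W.IsGloballyMinimal],
    ¬ W.HasCM → GoodOrd W 2 → ¬ W.HasIrreducibleModPGaloisRep 2 →
    ∀ (K : Type) [Field K] [NumberField K],
      (IsImaginaryQuadratic K ∧ SatisfiesHeegnerHypothesis (2 * W.conductorNorm ℤ) K) →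
      XGr₂CofgAt W K

/-- RresEq on the habitat (β): the residual span equality (research; R_alg ∧ R_KMC ∧ R_an). -/
def TwoVariableResidualSpanEqualityAtTwo : Prop :=
  ∀ (W : WeierstrassCurve ℚ) [W.IsElliptic] [W.IsGloballyMinimal],
    ¬ W.HasCM → GoodOrd W 2 → ¬ W.HasIrreducibleModPGaloisRep 2 →
    ∀ (K : Type) [Field K] [NumberField K],
      (IsImaginaryQuadratic K ∧ SatisfiesHeegnerHypothesis (2 * W.conductorNorm ℤ) K) →
      GreenbergResidualSpanEqForallAt W K

/-! ## §3 Registered stubs (v7): P0, S, PIN, CONTENT KERNEL by name; the stubs U, R0G, ACPIN (research) and P2, P3, P4, P5 (split-prime line: CFT / kernel / GL(1) print / kernel) are the ONLY sorries -/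

/-- **stub P0** (kernel algebra): principality of `ch_{Λ_K}(X_Gr(E/K̃_∞))` — KERNEL since tower-1 GEN 44 (p766476):
`ℤ₂⟦T₁,T₂⟧` is a UFD (`IwasawaTheory.uniqueFactorizationMonoid_iwasawaAlgebraTwoVar`); the torsion hypothesis is idle. -/
theorem stub_charIdealPrincipal : XGr₂CharIdealPrincipalAtTwo :=
  fun W _ _ K _ _ vbar κ₁ κ₂ γ₁ γ₂ _ h =>
    Summit.BirchSwinnertonDyer.BirchSwinnertonDyer.Theorems.TwoAdicBDPCharIdealPrincipal.exists_xGr₂_charIdeal_eq_span_two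
      W K vbar κ₁ κ₂ γ₁ γ₂ h

/-- **stub S** (kernel algebra): Gauss rigidity over `𝒪_{ℂ₂}⟦T₁,T₂⟧` — KERNEL since tower-1 GEN 44 (p766427; master
lemma `TwoAdicBDPGaussContent.forall_norm_coeff_le_of_forall_norm_coeff_mul_le`, the graded-lex ultrametric content
argument).  CAUTION retained: the slack MUST be a power of `2` (general slack is false: `C = T₁+2`, `G = T₁+4`). -/
theorem stub_gaussRigidity : GaussRigidity₂ :=
  fun C G h m h₁ h₂ h₃ =>
    Summit.BirchSwinnertonDyer.BirchSwinnertonDyer.Theorems.TwoAdicBDPGaussContent.span_le_span_of_two_pow_mul_eq_of_residue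
      C G h m h₁ h₂ h₃

/-- **stub U** (research, XL; barrier-adjacent `EulerSystemBigImageAtSmallImage`, evaded by the RATIONAL currency):
the two-variable Euler-system (Beilinson–Flach / BDP explicit reciprocity) inclusion at `2` on habitat (β), up to a
power of `2`, for EVERY admissible frame datum.  UNPRINTED at `p = 2` (LLZ/KLZ/BDP reciprocity laws are `p` odd; the
tree's ordinary theorem `span_le_charIdealXGr₂_map_of_goodOrd` is `p ≥ 5` + big image). -/
theorem stub_upperInclusionRat : TwoVariableUpperInclusionRatAtTwo := by
  sorry

/-- **stub R0G** (research, L; v6 — split out of v5's `stub_frameTorsion`, whose torsion part is now a theorem and whose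
Katz half is PRINT): on habitat (β), for every embedding datum, adapted pair and admissible Katz datum `(Ω, δ, Ωp, LK)` at
the split `2`, a two-variable Greenberg series `G = 𝓛_2^Gr(E/K) ∈ 𝒪_{ℂ₂}⟦T₁,T₂⟧` EXISTS relative to it
(`IsGreenbergLFunctionFree₂ … LK G`).  THE unprinted object at `2` (Castella–Hsieh Thm. 4.8 / CGS Thm. 2.4.1 / BSTW §9:
`p` odd; Kriz–Li 2019 at `2` is value-level; presearch g11: none at `2`). -/
theorem stub_greenbergFunctionFree : TwoVariableGreenbergObjectAtTwo := by
  sorry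

/-! ### The v7 stubs replacing v6's `stub_lineFinite` (FINLINE₂ ∀-pairs): P2, P3, P4, P5 of seat 2's split-prime line -/

/-- **stub P2 SPLIT-PAIR-EXISTS** (kernel CFT, M; ATTACKABLE): for `K` imaginary quadratic with `2 = v v̄` split there is an
adapted top-generator pair `(κ₁, κ₂; γ₁, γ₂)` of `K̃_∞/K` whose second line `κ₂` is ramified only at `v` — the `ℤ₂`-quotient of
`Gal(K(v^∞)/K) ≅ (ℤ₂^× / ⟨±1⟩) × (finite)` is a PRIMITIVE element of `Hom(Gal(K̃_∞/K), ℤ₂) ≅ ℤ₂²` (it is surjective), so it extends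
to a `ℤ₂`-basis; dual elements `γ₁, γ₂` lift to `Γ_K`.  Needs the tree's CFT for the existence of `κ_v` as a `ZpExtension K 2`. -/
theorem stub_splitPrimePairExists : SplitPrimePairExistsAtTwo := by
  sorry

/-- **stub P3 PAIR-TRANSPORT₂** (kernel, M; ATTACKABLE — tower-1 GEN 49 key, director (W1)): `Module.IsTorsion Λ₂ X_Gr₂` and the
residual non-vanishing of the characteristic generators are invariant under a change of adapted top-generator pair at the same
strict prime `v̄` (`X_Gr₂ … κ₁ κ₂ v̄ γ₁ γ₂` and `X_Gr₂ … κ₁' κ₂' v̄ γ₁' γ₂'` are the same `ℤ₂⟦Gal(K̃_∞/K)⟧`-module read in two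
coordinate systems `γ_i ↔ 1 + T_i`; the tree's `IwasawaAlgebraTwoVarGeneratorChange` is the natural tool). -/
theorem stub_torsionResidueTransport : TorsionResidueTransportAtTwo := by
  sorry

/-- **stub P4 GL1-FIN** (GL(1) PRINT leaf at `p = 2`, S): for `K` imaginary quadratic, `2 = v v̄`, every `ℤ₂`-line `κ` ramified only
at `v` and every finite `S₀`: `{t ∈ datumSelmerInfty κ (ℚ₂/ℤ₂) (bdpData v̄) S₀ | 2•t = 0}` is finite — `Hom(𝔛^{S₀}, ℤ/2)` for
`𝔛^{S₀}` = the Galois group of the maximal abelian pro-2 extension of `K_∞^{(v)}` unramified outside `{v} ∪ S₀` and split above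
`v̄`, finitely generated over `ℤ₂` because `X_∞ = Gal(M_∞/K_∞^{(v)})` (unramified outside `v`) is `Λ`-torsion (Greenberg 1978 /
Coates–Wiles) with `μ = 0` for ALL `p` (Oukhaba–Viguié 2016 Thm 1.2 [cite: arXiv:1311.3565, Thm 1.2]; for `ℚ(√−7)` even
`X_∞ = 0`, Choi–Kezuka–Li 2019 Thm 1.1 [cite: arXiv:1711.01697]) and the finitely many places above `S₀` (every `𝔮 ∤ v` is finitely
decomposed in `K_∞^{(v)}`: the image of a generator of `𝔮^{h_K}` in `K_v = ℚ₂` is a unit `≠ ±1`) contribute pro-2 tame inertia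
`≅ ℤ₂` each.  Becomes an admissible named hypothesis once the typer vendors the three print facts (pen SUMMON «P4-PRINT»). -/
theorem stub_trivialCharSplitLineFinite : TrivialCharSplitLineFiniteAtTwo := by
  sorry

/-- **stub P5 DEV** (kernel Galois cohomology, M/L; ATTACKABLE): for `W/ℚ` with `E[2]` reducible and any `K`, GL1-FIN ⟹ FIN-SPLIT:
along `0 → 𝟙 → E[2] → 𝟙 → 0` the set `{t ∈ Sel^{BDP}(K_∞^{(v)}, E[2^∞]) | 2t = 0}` is bounded by two trivial-character sets
(`H¹(E[2]) ↠ H¹(E[2^∞])[2]` with finite kernel `E(K_∞^{(v)})[2^∞]/2`; at good odd places `Hom(I_w, ℤ/2) ↪ H¹(I_w, E[2^∞])`, so the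
image character is unramified outside `S₀ = ` bad places; the strict condition above `v̄` passes to the quotient character and
constrains the sub-character up to a finite local ambiguity at the finitely many places above `v̄`; count with
`finite_of_finite_image_of_finite_inter_ker`). -/
theorem stub_eisensteinDevissage : EisensteinDevissageAtTwo := by
  sorry

/-! ### §ACPIN (v5, seat 1's resplit, verbatim): pin the cofactor at a PRIME of the special fibre

Decls `FibrePinned`, `PrimePinning₂`, `TwoContent₂`, `GreenbergAcFibrePinningAt`, `AcFibrePinningAtTwo` and the node
`bdpSelmerLowerDivisibilityAtTwo_of_acPieces` are VERBATIM those of `Lines/anticyclotomic_fibre_pinning_two.lean`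
(planner-cruxidea-stmt-BirchSwinnertonDyer-24728-1 GEN 3); the kernel proofs of PIN/CONTENT are imported by name from the lead's
`Theorems/TwoAdicConverseBDPSelmerLowerDivisibilityAtTwoPrimePinning.lean` (p768124). -/

/-- **FibrePinned G C'** (seat 1, verbatim) — SOME prime `𝔓` of `𝔽̄₂⟦T₁,T₂⟧` with (N) `red G ∉ 𝔓` and (Λ) for every primitive part
`C₁` of `C'` (`C' = 2^a·C₁`, `red C₁ ≠ 0`): `red C₁ ∈ 𝔓 + (red G)`. -/
def FibrePinned (G C' : A₂) : Prop :=
  ∃ 𝔓 : Ideal Ω₂, 𝔓.IsPrime ∧ red₂ G ∉ 𝔓 ∧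
    ∀ (a : ℕ) (C₁ : A₂), C' = (2 : A₂) ^ a * C₁ → red₂ C₁ ≠ 0 → red₂ C₁ ∈ 𝔓 ⊔ Ideal.span {red₂ G}

/-- **PIN** (seat 1, verbatim): `2^m·G = 2^a·C₁·h`, `red C₁ ≠ 0`, prime `𝔓` with `red G ∉ 𝔓`, `red C₁ ∈ 𝔓 + (red G)` ⟹
`(2^a·C₁) ⊆ (G)`.  KERNEL (p768124). -/
def PrimePinning₂ : Prop :=
  ∀ (C₁ G h : A₂) (a m : ℕ) (𝔓 : Ideal Ω₂), 𝔓.IsPrime →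
    (2 : A₂) ^ m * G = (2 : A₂) ^ a * C₁ * h → red₂ C₁ ≠ 0 → red₂ G ∉ 𝔓 →
    red₂ C₁ ∈ 𝔓 ⊔ Ideal.span {red₂ G} → Ideal.span {(2 : A₂) ^ a * C₁} ≤ Ideal.span {G}

/-- **CONTENT** (seat 1, verbatim): every nonzero `C₀ ∈ ℤ₂⟦T₁,T₂⟧` reads as `2^a·C₁` with `red C₁ ≠ 0`.  KERNEL (p768124). -/
def TwoContent₂ : Prop :=
  ∀ (J : ℤ_[2] →+* PadicComplexInt 2) (C₀ : IwasawaAlgebra₂ 2), C₀ ≠ 0 →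
    ∃ (a : ℕ) (C₁ : A₂), toUnr₂ 2 J C₀ = (2 : A₂) ^ a * C₁ ∧ red₂ C₁ ≠ 0

/-- **stub PIN** (kernel algebra) — by name from p768124 `TwoAdicBDPPrimePinning.span_le_span_of_prime_pin_two`. -/
theorem stub_primePinning : PrimePinning₂ :=
  fun C₁ G h a m 𝔓 h𝔓 h₁ h₂ h₃ h₄ =>
    Summit.BirchSwinnertonDyer.BirchSwinnertonDyer.Theorems.TwoAdicBDPPrimePinning.span_le_span_of_prime_pin_two
      C₁ G h a m 𝔓 h𝔓 h₁ h₂ h₃ h₄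

/-- **stub CONTENT** (kernel algebra) — by name from p768124 `TwoAdicBDPPrimePinning.exists_toUnr₂_eq_two_pow_mul_of_ne_zero`. -/
theorem stub_twoContent : TwoContent₂ :=
  fun J C₀ hC₀ =>
    Summit.BirchSwinnertonDyer.BirchSwinnertonDyer.Theorems.TwoAdicBDPPrimePinning.exists_toUnr₂_eq_two_pow_mul_of_ne_zero J C₀ hC₀

/-- **ACPIN at `(E,K)`** (seat 1, verbatim) — for every admissible frame datum, every structure map `J` and every generator
`C₀` of `ch_{Λ_K}(X_Gr(E/K̃_∞))`: `FibrePinned G (J C₀)` — some prime `𝔓` of the special fibre (INTENDED: the residual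
anticyclotomic line in the pair's coordinates) carries (N) `μ(G|_𝔓) = 0` and (Λ) `λ(G|_𝔓) ≤ λ(C₁|_𝔓)` for the primitive
part `C₁` of `J C₀`.  No algebraic `μ = 0`, no two-variable ideal equality. -/
def GreenbergAcFibrePinningAt (W : WeierstrassCurve ℚ) [W.IsElliptic] [W.IsGloballyMinimal]
    (K : Type) [Field K] [NumberField K] : Prop :=
  ∀ [IsCMField K] (ι : PadicAlgCl 2 ≃+* ℂ) (v vbar : HeightOneSpectrum (𝓞 K)) (κ₁ κ₂ : ZpExtension K 2)
    (γ₁ γ₂ : absoluteGaloisGroup K) [Fact (ZpExtension.IsTopGeneratorPair κ₁ κ₂ γ₁ γ₂)]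
    [NeZero (W.conductorNorm ℤ)] (f : CuspForm (Gamma0 (W.conductorNorm ℤ)) 2),
    ModularForms.IsNewformOf W f → ∀ [NeZero (NumberField.discr K).natAbs],
    ((2 : ℕ) : 𝓞 K) ∈ v.asIdeal → ((2 : ℕ) : 𝓞 K) ∈ vbar.asIdeal → vbar ≠ v →
    (∀ (w : InfinitePlace K) (k : 𝓞 K), k ∈ v.asIdeal ↔ ‖ι.symm (w.embedding (k : K))‖ < 1) →
    ∀ (Ω δ : ℂ) (Ωp : (unrIntegers 2)ˣ) (LK G : A₂),
      Ω ≠ 0 → (δ ^ 2 = (NumberField.discr K : ℂ) ∨ δ ^ 2 = -(NumberField.discr K : ℂ)) →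
      IsKatzMeasure₂ ι v vbar ∅ κ₁ κ₂ γ₁⁻¹ γ₂⁻¹ 1 Ω δ ((Ωp : unrIntegers 2) : ℂ_[2]) LK →
      IsGreenbergLFunctionFree₂ ι v vbar κ₁ κ₂ γ₁⁻¹ γ₂⁻¹ f (NumberField.discr K).natAbs
        (NumberField.classNumber K) LK G →
      ∀ J : ℤ_[2] →+* PadicComplexInt 2,
        (∀ x : ℤ_[2], ((J x : PadicComplexInt 2) : ℂ_[2]) = ((x : ℚ_[2]) : ℂ_[2])) →
        ∀ C₀ : IwasawaAlgebra₂ 2,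
          WeierstrassCurve.XGr₂.charIdeal (W.baseChange K) 2 κ₁ κ₂ vbar γ₁ γ₂ = Ideal.span {C₀} →
          FibrePinned G (toUnr₂ 2 J C₀)

/-- **ACPIN on the habitat (β)** (seat 1, verbatim). -/
def AcFibrePinningAtTwo : Prop :=
  ∀ (W : WeierstrassCurve ℚ) [W.IsElliptic] [W.IsGloballyMinimal],
    ¬ W.HasCM → GoodOrd W 2 → ¬ W.HasIrreducibleModPGaloisRep 2 →
    ∀ (K : Type) [Field K] [NumberField K],
      (IsImaginaryQuadratic K ∧ SatisfiesHeegnerHypothesis (2 * W.conductorNorm ℤ) K) →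
      GreenbergAcFibrePinningAt W K

/-- **stub ACPIN** (research, XL; HONEST HARDEST — leaves N_ac: `μ = 0` of `G` along the residual anticyclotomic line at `2`
(Hida/Hsieh/BCS `p` odd; INSTRUMENTABLE), Λ_ac: the one-line CM congruence at `2` (Kriz 2016 Thm. 3, hypothesis only `p ∤ N`;
constant `1/(4𝔤(ψ₂⁻¹))` to audit) + GL(1)/K main conjecture at `2` (Kezuka 2019 / Müller 2020) + GV bookkeeping at `2` —
seat 2 g4's `residual_selmer_control_two` re-types Λ_ac in `λ`-currency under P1 PURITY₂ / P2 / P3): on habitat (β), for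
every admissible frame datum, every `J`, every generator `C₀` of `ch(X_Gr)`, `FibrePinned G (toUnr₂ 2 J C₀)`. -/
theorem stub_acFibrePinning : AcFibrePinningAtTwo := by
  sorry

/-! ## §4 The discharges BY NAME (v6): COFGEN₂ (tower-1 GEN 46), TORSION and `μ₂ = 0` from FINLINE₂ (tower-1 GEN 47), the Katz half (lead's p767724) -/

/-- **COFGEN₂ is a THEOREM** at every datum (tower-1 GEN 46 p768155 `TwoAdicBDPCofiniteGeneration.moduleFinite_xGr₂_baseChange_two`,
no hypothesis on `W / K / pair / v̄`). -/
theorem xGr₂Cofg_holds (W : WeierstrassCurve ℚ) [W.IsElliptic] [W.IsGloballyMinimal] (K : Type) [Field K] [NumberField K] :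
    XGr₂CofgAt W K :=
  fun _ vbar κ₁ κ₂ γ₁ γ₂ _ _ _ _ =>
    Summit.BirchSwinnertonDyer.BirchSwinnertonDyer.Theorems.TwoAdicBDPCofiniteGeneration.moduleFinite_xGr₂_baseChange_two
      W K κ₁ κ₂ vbar γ₁ γ₂

/-- COFGEN₂ on the habitat: a theorem (no stub). -/
theorem twoVariableCofgAtTwo_holds : TwoVariableCofgAtTwo :=
  fun W _ _ _ _ _ K _ _ _ => xGr₂Cofg_holds W K

/-- **R0T ⟸ R0F ∧ FINLINE₂ at a datum** (`K` imaginary quadratic): the torsion conjunct of the OBJECT half from ONE line, BY NAME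
(`TwoAdicBDPTowerLineControl.xGr₂_baseChange_two_isTorsion_of_lineFinite`, tower-1 GEN 47 p769393; FD discharged inside by
`ZpExtension.not_decomp_le_kerSubgroup_of_isImaginaryQuadratic`, COFGEN₂ inside by GEN 46). -/
theorem greenbergFrameTorsionAt_of_frame_of_lineSelmerFinite (W : WeierstrassCurve ℚ) [W.IsElliptic] [W.IsGloballyMinimal]
    (K : Type) [Field K] [NumberField K] (hK : IsImaginaryQuadratic K)
    (hF : GreenbergFrameAt W K) (hL : XGr₂LineSelmerFiniteAt W K) : GreenbergFrameTorsionAt W K := by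
  intro _ ι v vbar κ₁ κ₂ γ₁ γ₂ _ _ f hf _ hv hvbar hne hι
  obtain ⟨Ω, δ, Ωp, LK, G, hΩ, hδ, hLK, hG⟩ := hF ι v vbar κ₁ κ₂ γ₁ γ₂ f hf hv hvbar hne hι
  exact ⟨Ω, δ, Ωp, LK, G, hΩ, hδ, hLK, hG,
    Summit.BirchSwinnertonDyer.BirchSwinnertonDyer.Theorems.TwoAdicBDPTowerLineControl.xGr₂_baseChange_two_isTorsion_of_lineFinite
      W K hK κ₁ κ₂ vbar hvbar γ₁ γ₂ (hL v vbar κ₁ κ₂ γ₁ γ₂ hv hvbar hne)⟩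

/-- **Rres ⟸ FINLINE₂ ∧ RresEq at a datum** (`K` imaginary quadratic): the `μ₂ = 0` clause `red(toUnr₂ J C) ≠ 0` from ONE line,
BY NAME (`TwoAdicBDPTowerLineControl.xGr₂_baseChange_two_map_residue_toUnr₂_ne_zero_of_lineFinite`, tower-1 GEN 47 p769393). -/
theorem greenbergResidualEqualityForallAt_of_lineSelmerFinite_of_spanEq (W : WeierstrassCurve ℚ) [W.IsElliptic]
    [W.IsGloballyMinimal] (K : Type) [Field K] [NumberField K] (hK : IsImaginaryQuadratic K)
    (hL : XGr₂LineSelmerFiniteAt W K) (hE : GreenbergResidualSpanEqForallAt W K) :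
    GreenbergResidualEqualityForallAt W K := by
  intro _ ι v vbar κ₁ κ₂ γ₁ γ₂ _ _ f hf _ hv hvbar hne hι Ω δ Ωp LK G hΩ hδ hLK hG J hJ C hC
  exact ⟨Summit.BirchSwinnertonDyer.BirchSwinnertonDyer.Theorems.TwoAdicBDPTowerLineControl.xGr₂_baseChange_two_map_residue_toUnr₂_ne_zero_of_lineFinite
      W K hK κ₁ κ₂ vbar hvbar γ₁ γ₂ (hL v vbar κ₁ κ₂ γ₁ γ₂ hv hvbar hne) J hC,
    hE ι v vbar κ₁ κ₂ γ₁ γ₂ f hf hv hvbar hne hι Ω δ Ωp LK G hΩ hδ hLK hG J hJ C hC⟩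

/-- **R0F ⟸ de Shalit II.4.17 ∧ R0G at a datum** (`K` imaginary quadratic), by name from the lead's p767724
(`TwoAdicBDPKatzFrame.exists_frame_two_of_katzSheet_of_forall_katz`). -/
theorem greenbergFrameAt_of_katzSheet_of_object (hdS : DeShalit1987.thmII417_exists_katzSheet)
    (W : WeierstrassCurve ℚ) [W.IsElliptic] [W.IsGloballyMinimal] (K : Type) [Field K] [NumberField K]
    (hK : IsImaginaryQuadratic K) (hG : GreenbergObjectAt W K) : GreenbergFrameAt W K := by
  intro _ ι v vbar κ₁ κ₂ γ₁ γ₂ hpair _ f hf _ hv hvbar hne hι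
  exact Summit.BirchSwinnertonDyer.BirchSwinnertonDyer.Theorems.TwoAdicBDPKatzFrame.exists_frame_two_of_katzSheet_of_forall_katz
    hdS W hK ι v vbar κ₁ κ₂ γ₁ γ₂ hpair.out f hv hvbar hne hι (hG ι v vbar κ₁ κ₂ γ₁ γ₂ f hf hv hvbar hne hι)

/-- `PRINT{thmII417} → R0G → R0F` on the habitat (`IsImaginaryQuadratic K` read off the habitat clause). -/
theorem frameAtTwo_of_katzSheet_of_object (hdS : DeShalit1987.thmII417_exists_katzSheet) :
    TwoVariableGreenbergObjectAtTwo → TwoVariableFrameAtTwo :=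
  fun hG W _ _ hCM hGO hβ K _ _ hK =>
    greenbergFrameAt_of_katzSheet_of_object hdS W K hK.1 (hG W hCM hGO hβ K hK)

/-- `R0F → FINLINE₂ → R0T` on the habitat (by name from tower-1 GEN 46/47). -/
theorem frameTorsion_of_frame_of_lineFinite :
    TwoVariableFrameAtTwo → TwoVariableLineSelmerFiniteAtTwo → TwoVariableFrameTorsionAtTwo :=
  fun hF hL W _ _ hCM hGO hβ K _ _ hK =>
    greenbergFrameTorsionAt_of_frame_of_lineSelmerFinite W K hK.1 (hF W hCM hGO hβ K hK) (hL W hCM hGO hβ K hK)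

/-- **`PRINT{thmII417} → R0G → FINLINE₂ → R0T` on the habitat** — v5's research stub `stub_frameTorsion` is this THEOREM
modulo the print and the two v6 stubs R0G, FINLINE₂. -/
theorem frameTorsion_of_katzSheet_of_object_of_lineFinite (hdS : DeShalit1987.thmII417_exists_katzSheet) :
    TwoVariableGreenbergObjectAtTwo → TwoVariableLineSelmerFiniteAtTwo → TwoVariableFrameTorsionAtTwo :=
  fun hG hL => frameTorsion_of_frame_of_lineFinite (frameAtTwo_of_katzSheet_of_object hdS hG) hL

/-- `FINLINE₂ → RresEq → Rres` on the habitat (by name from tower-1 GEN 47). -/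
theorem residualEqualityForall_of_lineFinite_of_spanEq :
    TwoVariableLineSelmerFiniteAtTwo → TwoVariableResidualSpanEqualityAtTwo → TwoVariableResidualEqualityForallAtTwo :=
  fun hL hE W _ _ hCM hGO hβ K _ _ hK =>
    greenbergResidualEqualityForallAt_of_lineSelmerFinite_of_spanEq W K hK.1 (hL W hCM hGO hβ K hK) (hE W hCM hGO hβ K hK)

/-! ### §4-v7 The split-prime seam (seat 2 GEN 6, KERNEL, verbatim) and the torsion/residue consumers -/

/-- **Node seam (seat 2, verbatim).**  For `K` imaginary quadratic: finiteness on the v-ramified lines, existence of a split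
adapted pair and pair transport give, at EVERY adapted pair, the torsion of `X_Gr((E_K)/K̃_∞)` and the residual non-vanishing of
its characteristic generators — through the tree doors of `TwoAdicBDPTowerLineControl` (tower-1 GEN 47 p769393). -/
theorem torsionResidueForall_of_splitLine (W : WeierstrassCurve ℚ) [W.IsElliptic] (K : Type) [Field K]
    [NumberField K] (hK : IsImaginaryQuadratic K) (hfin : SplitPrimeLineSelmerFiniteAt W K)
    (hex : SplitPrimePairExistsAt K) (htr : TorsionResidueTransportAt W K) : TorsionResidueForallAt W K := by
  intro _ v vbar hv hvbar hne κ₁ κ₂ γ₁ γ₂ _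
  obtain ⟨κ₁', κ₂', γ₁', γ₂', hpair', hram⟩ := hex hK v vbar hv hvbar hne
  haveI : Fact (ZpExtension.IsTopGeneratorPair κ₁' κ₂' γ₁' γ₂') := ⟨hpair'⟩
  have hline : LineSelmerTwoTorsionFinite W K κ₂' vbar := hfin hK v vbar κ₂' hv hvbar hne hram
  obtain ⟨htor, hres⟩ := htr hK vbar hvbar κ₁ κ₂ κ₁' κ₂' γ₁ γ₂ γ₁' γ₂'
  refine ⟨htor (xGr₂_baseChange_two_isTorsion_of_lineFinite W K hK κ₁' κ₂' vbar hvbar γ₁' γ₂' hline), ?_⟩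
  exact hres fun J C₀ hC ↦
    xGr₂_baseChange_two_map_residue_toUnr₂_ne_zero_of_lineFinite W K hK κ₁' κ₂' vbar hvbar γ₁' γ₂' hline J hC

/-- Sub-node seam (seat 2, verbatim; modus ponens — the content is in DEV and GL1-FIN). -/
theorem splitPrimeLineSelmerFinite_of_devissage (W : WeierstrassCurve ℚ) [W.IsElliptic] (K : Type) [Field K]
    [NumberField K] (hdev : EisensteinDevissageAt W K) (hred : ¬ W.HasIrreducibleModPGaloisRep 2)
    (hgl1 : TrivialCharSplitLineFiniteAt K) : SplitPrimeLineSelmerFiniteAt W K :=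
  hdev hred hgl1

/-- **First brick of DEV (seat 2, verbatim; kernel): the counting dévissage.**  If an additive map `f` has finite image on a
subgroup `S` and `S` meets `ker f` in a finite set, then `S` is finite (`|S| ≤ |f(S)|·|S ∩ ker f|`). -/
theorem finite_of_finite_image_of_finite_inter_ker {B C : Type*} [AddCommGroup B] [AddCommGroup C] (f : B →+ C)
    (S : AddSubgroup B) (himg : (f '' (S : Set B)).Finite) (hker : ((S : Set B) ∩ {b | f b = 0}).Finite) :
    (S : Set B).Finite := by
  have hsec : ∀ c ∈ f '' (S : Set B), ∃ s ∈ (S : Set B), f s = c := fun c hc ↦ by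
    obtain ⟨s, hs, rfl⟩ := hc
    exact ⟨s, hs, rfl⟩
  choose! g hgS hgf using hsec
  have hsub : (S : Set B) ⊆
      (fun q : C × B ↦ g q.1 + q.2) '' ((f '' (S : Set B)) ×ˢ ((S : Set B) ∩ {b | f b = 0})) := by
    intro s hs
    have hfs : f s ∈ f '' (S : Set B) := ⟨s, hs, rfl⟩
    refine ⟨(f s, s - g (f s)), ⟨hfs, ?_, ?_⟩, ?_⟩
    · exact S.sub_mem hs (hgS (f s) hfs)
    · show f (s - g (f s)) = 0
      rw [map_sub, hgf (f s) hfs, sub_self]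
    · show g (f s) + (s - g (f s)) = s
      abel
  exact ((himg.prod hker).image _).subset hsub

/-- **v6's FINLINE₂ (∀ pairs) is STRONGER than what the node consumes**: it gives torsion ∧ residue at every pair directly through
the doors (no transport, no split line).  Sorry-free; FINLINE₂ is no longer a stub. -/
theorem torsionResidueForallAt_of_lineSelmerFinite (W : WeierstrassCurve ℚ) [W.IsElliptic] [W.IsGloballyMinimal]
    (K : Type) [Field K] [NumberField K] (hL : XGr₂LineSelmerFiniteAt W K) : TorsionResidueForallAt W K := by
  intro hK v vbar hv hvbar hne κ₁ κ₂ γ₁ γ₂ _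
  exact ⟨xGr₂_baseChange_two_isTorsion_of_lineFinite W K hK κ₁ κ₂ vbar hvbar γ₁ γ₂ (hL v vbar κ₁ κ₂ γ₁ γ₂ hv hvbar hne),
    fun J C₀ hC => xGr₂_baseChange_two_map_residue_toUnr₂_ne_zero_of_lineFinite W K hK κ₁ κ₂ vbar hvbar γ₁ γ₂
      (hL v vbar κ₁ κ₂ γ₁ γ₂ hv hvbar hne) J hC⟩

/-- **R0T ⟸ R0F ∧ (TORSION ∧ RESIDUE) at a datum** (`K` imaginary quadratic) — the v7 consumer of the object half. -/
theorem greenbergFrameTorsionAt_of_frame_of_torsionResidue (W : WeierstrassCurve ℚ) [W.IsElliptic] [W.IsGloballyMinimal]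
    (K : Type) [Field K] [NumberField K] (hK : IsImaginaryQuadratic K)
    (hF : GreenbergFrameAt W K) (hT : TorsionResidueForallAt W K) : GreenbergFrameTorsionAt W K := by
  intro _ ι v vbar κ₁ κ₂ γ₁ γ₂ _ _ f hf _ hv hvbar hne hι
  obtain ⟨Ω, δ, Ωp, LK, G, hΩ, hδ, hLK, hG⟩ := hF ι v vbar κ₁ κ₂ γ₁ γ₂ f hf hv hvbar hne hι
  exact ⟨Ω, δ, Ωp, LK, G, hΩ, hδ, hLK, hG, (hT hK v vbar hv hvbar hne κ₁ κ₂ γ₁ γ₂).1⟩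

/-- **Rres ⟸ (TORSION ∧ RESIDUE) ∧ RresEq at a datum** (`K` imaginary quadratic) — the v7 consumer on the RresEq road
(`ResidueNonvanishing J C` IS `red₂ (toUnr₂ 2 J C) ≠ 0`). -/
theorem greenbergResidualEqualityForallAt_of_torsionResidue_of_spanEq (W : WeierstrassCurve ℚ) [W.IsElliptic]
    [W.IsGloballyMinimal] (K : Type) [Field K] [NumberField K] (hK : IsImaginaryQuadratic K)
    (hT : TorsionResidueForallAt W K) (hE : GreenbergResidualSpanEqForallAt W K) :
    GreenbergResidualEqualityForallAt W K := by
  intro _ ι v vbar κ₁ κ₂ γ₁ γ₂ _ _ f hf _ hv hvbar hne hι Ω δ Ωp LK G hΩ hδ hLK hG J hJ C hC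
  exact ⟨(hT hK v vbar hv hvbar hne κ₁ κ₂ γ₁ γ₂).2 J C hC,
    hE ι v vbar κ₁ κ₂ γ₁ γ₂ f hf hv hvbar hne hι Ω δ Ωp LK G hΩ hδ hLK hG J hJ C hC⟩

/-- **`P2 → P3 → P4 → P5 → (TORSION ∧ RESIDUE)` on the habitat** — seat 2's seam fed by the four v7 stubs' shapes; the habitat supplies
`IsImaginaryQuadratic K` (`hK.1`) and `¬ Irr E[2]` (`hβ`). -/
theorem torsionResidue_of_splitPieces :
    SplitPrimePairExistsAtTwo → TorsionResidueTransportAtTwo → TrivialCharSplitLineFiniteAtTwo → EisensteinDevissageAtTwo →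
      TwoVariableTorsionResidueAtTwo :=
  fun hex htr hgl1 hdev W _ _ _ _ hβ K _ _ hK =>
    torsionResidueForall_of_splitLine W K hK.1
      (splitPrimeLineSelmerFinite_of_devissage W K (hdev W K) hβ (hgl1 K)) (hex K) (htr W K)

/-- `FINLINE₂ → (TORSION ∧ RESIDUE)` on the habitat (v6's stub as a stronger input). -/
theorem torsionResidue_of_lineFinite : TwoVariableLineSelmerFiniteAtTwo → TwoVariableTorsionResidueAtTwo :=
  fun hL W _ _ hCM hGO hβ K _ _ hK => torsionResidueForallAt_of_lineSelmerFinite W K (hL W hCM hGO hβ K hK)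

/-- `R0F → (TORSION ∧ RESIDUE) → R0T` on the habitat. -/
theorem frameTorsion_of_frame_of_torsionResidue :
    TwoVariableFrameAtTwo → TwoVariableTorsionResidueAtTwo → TwoVariableFrameTorsionAtTwo :=
  fun hF hT W _ _ hCM hGO hβ K _ _ hK =>
    greenbergFrameTorsionAt_of_frame_of_torsionResidue W K hK.1 (hF W hCM hGO hβ K hK) (hT W hCM hGO hβ K hK)

/-- **`PRINT{thmII417} → R0G → (TORSION ∧ RESIDUE) → R0T` on the habitat** — v7's form of v5's `stub_frameTorsion`. -/
theorem frameTorsion_of_katzSheet_of_object_of_torsionResidue (hdS : DeShalit1987.thmII417_exists_katzSheet) :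
    TwoVariableGreenbergObjectAtTwo → TwoVariableTorsionResidueAtTwo → TwoVariableFrameTorsionAtTwo :=
  fun hG hT => frameTorsion_of_frame_of_torsionResidue (frameAtTwo_of_katzSheet_of_object hdS hG) hT

/-- `(TORSION ∧ RESIDUE) → RresEq → Rres` on the habitat. -/
theorem residualEqualityForall_of_torsionResidue_of_spanEq :
    TwoVariableTorsionResidueAtTwo → TwoVariableResidualSpanEqualityAtTwo → TwoVariableResidualEqualityForallAtTwo :=
  fun hT hE W _ _ hCM hGO hβ K _ _ hK =>
    greenbergResidualEqualityForallAt_of_torsionResidue_of_spanEq W K hK.1 (hT W hCM hGO hβ K hK) (hE W hCM hGO hβ K hK)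

/-! ## §5 The nodes (sorry-free implications concluding `O2Goal`) and the composition (concludes the crux BY NAME) -/

/-- **THE ACPIN NODE (v5, seat 1 verbatim)** `O2 ⟸ P0 ∧ PIN ∧ CONTENT ∧ U ∧ R0T ∧ ACPIN`.  Given the frame from R0T, a generator
`C₀` from P0, the slack `2^m G ∈ (J C₀)` from U, the content decomposition `J C₀ = 2^a C₁` from CONTENT and the prime `𝔓` from
ACPIN, PIN pins the cofactor: `(J C₀) ⊆ (G)`. -/
theorem bdpSelmerLowerDivisibilityAtTwo_of_acPieces :
    XGr₂CharIdealPrincipalAtTwo → PrimePinning₂ → TwoContent₂ → TwoVariableUpperInclusionRatAtTwo →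
      TwoVariableFrameTorsionAtTwo → AcFibrePinningAtTwo → O2Goal := by
  intro hP hPin hCt hU h0 hA W _ _ hCM hGO hβ K _ _ hK _ ι v vbar κ₁ κ₂ γ₁ γ₂ _ _ f hf _ hv hvbar hne hι
  obtain ⟨Ω, δ, Ωp, LK, G, hΩ, hδ, hLK, hG, htor⟩ :=
    h0 W hCM hGO hβ K hK ι v vbar κ₁ κ₂ γ₁ γ₂ f hf hv hvbar hne hι
  refine ⟨Ω, δ, Ωp, LK, G, hΩ, hδ, hLK, hG, htor, fun J hJ => ?_⟩
  obtain ⟨C₀, hC₀⟩ := hP W K vbar κ₁ κ₂ γ₁ γ₂ htor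
  obtain ⟨m, hm⟩ := hU W hCM hGO hβ K hK ι v vbar κ₁ κ₂ γ₁ γ₂ f hf hv hvbar hne hι Ω δ Ωp LK G hΩ hδ hLK hG J hJ
  obtain ⟨𝔓, h𝔓, hN, hΛ⟩ :=
    hA W hCM hGO hβ K hK ι v vbar κ₁ κ₂ γ₁ γ₂ f hf hv hvbar hne hι Ω δ Ωp LK G hΩ hδ hLK hG J hJ C₀ hC₀
  rw [hC₀, Ideal.map_span, Set.image_singleton] at hm ⊢
  obtain ⟨h, hh⟩ := Ideal.mem_span_singleton'.mp (hm (Ideal.mem_span_singleton_self _))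
  by_cases hC00 : C₀ = 0
  · rw [hC00, map_zero, Ideal.span_singleton_eq_bot.mpr rfl]
    exact bot_le
  · obtain ⟨a, C₁, haC₁, hC₁⟩ := hCt J C₀ hC00
    rw [haC₁] at hh ⊢
    exact hPin C₁ G h a m 𝔓 h𝔓 (by rw [← hh]; ring) hC₁ hN (hΛ a C₁ haC₁ hC₁)

/-- **The node over the pair-independent input: `O2 ⟸ PRINT{de Shalit II.4.17} ∧ U ∧ R0G ∧ (TORSION ∧ RESIDUE) ∧ ACPIN`, sorry-free**
(P0, PIN, CONTENT kernel by name). -/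
theorem bdpSelmerLowerDivisibilityAtTwo_of_katzSheet_of_torsionResidue_of_acPin (hdS : DeShalit1987.thmII417_exists_katzSheet) :
    TwoVariableUpperInclusionRatAtTwo → TwoVariableGreenbergObjectAtTwo → TwoVariableTorsionResidueAtTwo →
      AcFibrePinningAtTwo → O2Goal :=
  fun hU hG hT hA => bdpSelmerLowerDivisibilityAtTwo_of_acPieces stub_charIdealPrincipal stub_primePinning stub_twoContent hU
    (frameTorsion_of_katzSheet_of_object_of_torsionResidue hdS hG hT) hA

/-- ★ **THE NODE v7: `O2 ⟸ PRINT{de Shalit II.4.17} ∧ U ∧ R0G ∧ P2 ∧ P3 ∧ P4 ∧ P5 ∧ ACPIN`, sorry-free** (P0, PIN, CONTENT, COFGEN₂,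
the tower→line doors, FD and seat 2's split-prime seam KERNEL by name).  Research/kernel residue of the line = {U, R0G, ACPIN} ∪
{P2 (CFT), P3 (pair transport), P4 (GL(1) print at 2), P5 (Eisenstein dévissage)}; ONE printed named fact displayed. -/
theorem bdpSelmerLowerDivisibilityAtTwo_of_katzSheet_of_splitLine_of_acPin (hdS : DeShalit1987.thmII417_exists_katzSheet) :
    TwoVariableUpperInclusionRatAtTwo → TwoVariableGreenbergObjectAtTwo → SplitPrimePairExistsAtTwo →
      TorsionResidueTransportAtTwo → TrivialCharSplitLineFiniteAtTwo → EisensteinDevissageAtTwo →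
        AcFibrePinningAtTwo → O2Goal :=
  fun hU hG hex htr hgl1 hdev hA => bdpSelmerLowerDivisibilityAtTwo_of_katzSheet_of_torsionResidue_of_acPin hdS hU hG
    (torsionResidue_of_splitPieces hex htr hgl1 hdev) hA

/-- **THE NODE v6 (kept; FINLINE₂ now a STRONGER sorry-free input, not a stub): `O2 ⟸ PRINT ∧ U ∧ R0G ∧ FINLINE₂ ∧ ACPIN`.** -/
theorem bdpSelmerLowerDivisibilityAtTwo_of_katzSheet_of_lineFinite_of_acPin (hdS : DeShalit1987.thmII417_exists_katzSheet) :
    TwoVariableUpperInclusionRatAtTwo → TwoVariableGreenbergObjectAtTwo → TwoVariableLineSelmerFiniteAtTwo →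
      AcFibrePinningAtTwo → O2Goal :=
  fun hU hG hL hA => bdpSelmerLowerDivisibilityAtTwo_of_katzSheet_of_torsionResidue_of_acPin hdS hU hG
    (torsionResidue_of_lineFinite hL) hA

/-- **(TORSION ∧ RESIDUE) from the registered v7 stubs** P2, P3, P4, P5 (sorries there, none here). -/
theorem torsionResidue_of_registered : TwoVariableTorsionResidueAtTwo :=
  torsionResidue_of_splitPieces stub_splitPrimePairExists stub_torsionResidueTransport stub_trivialCharSplitLineFinite
    stub_eisensteinDevissage

/-- **v5's R0T as a theorem modulo the registered v7 stubs and the print leaf** (`KatzSheetTwoVariablePrint` :=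
`DeShalit1987.thmII417_exists_katzSheet`, ledger item stmt-BirchSwinnertonDyer-24085 of route `PrintCf2RubinValueTwo`). -/
theorem frameTorsion_of_registered (hKatz : Theses.PrintCf2RubinValueTwo.KatzSheetTwoVariablePrint) :
    TwoVariableFrameTorsionAtTwo :=
  frameTorsion_of_katzSheet_of_object_of_torsionResidue hKatz stub_greenbergFunctionFree torsionResidue_of_registered

/-- **THE SKELETON'S COMPOSITION (v7)** — `O2` BY NAME from the registered stubs `stub_charIdealPrincipal` (P0, kernel),
`stub_primePinning` (PIN, kernel), `stub_twoContent` (CONTENT, kernel), `stub_upperInclusionRat` (U),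
`stub_greenbergFunctionFree` (R0G), `stub_splitPrimePairExists` (P2), `stub_torsionResidueTransport` (P3),
`stub_trivialCharSplitLineFinite` (P4), `stub_eisensteinDevissage` (P5), `stub_acFibrePinning` (ACPIN), GIVEN the print leaf
`KatzSheetTwoVariablePrint` (= `DeShalit1987.thmII417_exists_katzSheet`, de Shalit 1987 II.4.17; a registered obligation of the
ledger, stmt-BirchSwinnertonDyer-24085 — not a sorry of this file).  No sorry of its own. -/
theorem BDPSelmerLowerDivisibilityAtTwo_of (hKatz : Theses.PrintCf2RubinValueTwo.KatzSheetTwoVariablePrint) :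
    BDPSelmerLowerDivisibilityAtTwo :=
  bdpSelmerLowerDivisibilityAtTwo_of_acPieces stub_charIdealPrincipal stub_primePinning stub_twoContent stub_upperInclusionRat
    (frameTorsion_of_registered hKatz) stub_acFibrePinning

/-! ### The RresEq road (v4.1 leaf, now over TORSION ∧ RESIDUE) and the derived pieces — all conclude `O2Goal` -/

/-- The split at a datum: R0T ∧ Rres ⇒ R (logic only; seat 2's v2 annex). -/
theorem greenbergResidualEqualityAt_of_frame_of_forall (W : WeierstrassCurve ℚ) [W.IsElliptic] [W.IsGloballyMinimal]
    (K : Type) [Field K] [NumberField K]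
    (h0 : GreenbergFrameTorsionAt W K) (hres : GreenbergResidualEqualityForallAt W K) :
    GreenbergResidualEqualityAt W K := by
  intro _ ι v vbar κ₁ κ₂ γ₁ γ₂ _ _ f hf _ hv hvbar hne hι
  obtain ⟨Ω, δ, Ωp, LK, G, hΩ, hδ, hLK, hG, htor⟩ := h0 ι v vbar κ₁ κ₂ γ₁ γ₂ f hf hv hvbar hne hι
  exact ⟨Ω, δ, Ωp, LK, G, hΩ, hδ, hLK, hG, htor, fun J hJ C hC =>
    hres ι v vbar κ₁ κ₂ γ₁ γ₂ f hf hv hvbar hne hι Ω δ Ωp LK G hΩ hδ hLK hG J hJ C hC⟩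

/-- `R0T → Rres → R` on the habitat, sorry-free (logic only). -/
theorem residualEquality_of_split :
    TwoVariableFrameTorsionAtTwo → TwoVariableResidualEqualityForallAtTwo → TwoVariableResidualEqualityAtTwo := by
  intro h0 hres W _ _ hCM hGO hβ K _ _ hK
  exact greenbergResidualEqualityAt_of_frame_of_forall W K (h0 W hCM hGO hβ K hK) (hres W hCM hGO hβ K hK)

/-- The seam as a SORRY-FREE implication: `O2 ⟸ P0 ∧ S ∧ U ∧ R` (logic + `Ideal` algebra over the tree's definitions). -/
theorem bdpSelmerLowerDivisibilityAtTwo_of_pieces :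
    XGr₂CharIdealPrincipalAtTwo → GaussRigidity₂ → TwoVariableUpperInclusionRatAtTwo →
      TwoVariableResidualEqualityAtTwo → O2Goal := by
  intro hP hS hU hR W _ _ hCM hGO hβ K _ _ hK _ ι v vbar κ₁ κ₂ γ₁ γ₂ _ _ f hf _ hv hvbar hne hι
  obtain ⟨Ω, δ, Ωp, LK, G, hΩ, hδ, hLK, hG, htor, hres⟩ :=
    hR W hCM hGO hβ K hK ι v vbar κ₁ κ₂ γ₁ γ₂ f hf hv hvbar hne hι
  refine ⟨Ω, δ, Ωp, LK, G, hΩ, hδ, hLK, hG, htor, fun J hJ => ?_⟩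
  obtain ⟨C, hC⟩ := hP W K vbar κ₁ κ₂ γ₁ γ₂ htor
  obtain ⟨m, hm⟩ := hU W hCM hGO hβ K hK ι v vbar κ₁ κ₂ γ₁ γ₂ f hf hv hvbar hne hι Ω δ Ωp LK G hΩ hδ hLK hG J hJ
  obtain ⟨hC0, hspan⟩ := hres J hJ C hC
  rw [hC, Ideal.map_span, Set.image_singleton] at hm ⊢
  obtain ⟨h, hh⟩ := Ideal.mem_span_singleton'.mp (hm (Ideal.mem_span_singleton_self _))
  exact hS (toUnr₂ 2 J C) G h m (by rw [← hh, mul_comm]) hC0 hspan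

/-- The node with R split: `O2 ⟸ P0 ∧ S ∧ U ∧ R0T ∧ Rres`, sorry-free. -/
theorem bdpSelmerLowerDivisibilityAtTwo_of_split_pieces :
    XGr₂CharIdealPrincipalAtTwo → GaussRigidity₂ → TwoVariableUpperInclusionRatAtTwo →
      TwoVariableFrameTorsionAtTwo → TwoVariableResidualEqualityForallAtTwo → O2Goal :=
  fun hP hS hU h0 hres => bdpSelmerLowerDivisibilityAtTwo_of_pieces hP hS hU (residualEquality_of_split h0 hres)

/-- ★ **THE TWIN NODE (RresEq leaf): `O2 ⟸ PRINT{de Shalit II.4.17} ∧ U ∧ R0G ∧ (TORSION ∧ RESIDUE) ∧ RresEq`, sorry-free** — here the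
torsion/residue input is used TWICE: for the torsion conjunct AND for the `μ₂ = 0` clause. -/
theorem bdpSelmerLowerDivisibilityAtTwo_of_katzSheet_of_torsionResidue_of_spanEq (hdS : DeShalit1987.thmII417_exists_katzSheet) :
    TwoVariableUpperInclusionRatAtTwo → TwoVariableGreenbergObjectAtTwo → TwoVariableTorsionResidueAtTwo →
      TwoVariableResidualSpanEqualityAtTwo → O2Goal :=
  fun hU hG hT hE => bdpSelmerLowerDivisibilityAtTwo_of_split_pieces stub_charIdealPrincipal stub_gaussRigidity hU
    (frameTorsion_of_katzSheet_of_object_of_torsionResidue hdS hG hT) (residualEqualityForall_of_torsionResidue_of_spanEq hT hE)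

/-- The twin node over v6's FINLINE₂ (stronger input): `O2 ⟸ PRINT ∧ U ∧ R0G ∧ FINLINE₂ ∧ RresEq`, sorry-free. -/
theorem bdpSelmerLowerDivisibilityAtTwo_of_katzSheet_of_lineFinite_of_spanEq (hdS : DeShalit1987.thmII417_exists_katzSheet) :
    TwoVariableUpperInclusionRatAtTwo → TwoVariableGreenbergObjectAtTwo → TwoVariableLineSelmerFiniteAtTwo →
      TwoVariableResidualSpanEqualityAtTwo → O2Goal :=
  fun hU hG hL hE => bdpSelmerLowerDivisibilityAtTwo_of_katzSheet_of_torsionResidue_of_spanEq hdS hU hG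
    (torsionResidue_of_lineFinite hL) hE

/-- The twin node v7 (RresEq leaf over the split-prime pieces): `O2 ⟸ PRINT ∧ U ∧ R0G ∧ P2 ∧ P3 ∧ P4 ∧ P5 ∧ RresEq`, sorry-free. -/
theorem bdpSelmerLowerDivisibilityAtTwo_of_katzSheet_of_splitLine_of_spanEq (hdS : DeShalit1987.thmII417_exists_katzSheet) :
    TwoVariableUpperInclusionRatAtTwo → TwoVariableGreenbergObjectAtTwo → SplitPrimePairExistsAtTwo →
      TorsionResidueTransportAtTwo → TrivialCharSplitLineFiniteAtTwo → EisensteinDevissageAtTwo →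
        TwoVariableResidualSpanEqualityAtTwo → O2Goal :=
  fun hU hG hex htr hgl1 hdev hE => bdpSelmerLowerDivisibilityAtTwo_of_katzSheet_of_torsionResidue_of_spanEq hdS hU hG
    (torsionResidue_of_splitPieces hex htr hgl1 hdev) hE

/-- **Nothing is lost: Rres ⇒ ACPIN at a datum** (seat 1's `fibrePinned_of_residualEquality` at `𝔓 = ⊥`, recomposed on the frame). -/
theorem greenbergAcFibrePinningAt_of_residualEqualityForall (W : WeierstrassCurve ℚ) [W.IsElliptic] [W.IsGloballyMinimal]
    (K : Type) [Field K] [NumberField K] (hres : GreenbergResidualEqualityForallAt W K) : GreenbergAcFibrePinningAt W K := by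
  intro _ ι v vbar κ₁ κ₂ γ₁ γ₂ _ _ f hf _ hv hvbar hne hι Ω δ Ωp LK G hΩ hδ hLK hG J hJ C₀ hC₀
  obtain ⟨hC', hGC⟩ := hres ι v vbar κ₁ κ₂ γ₁ γ₂ f hf hv hvbar hne hι Ω δ Ωp LK G hΩ hδ hLK hG J hJ C₀ hC₀
  refine ⟨⊥, Ideal.isPrime_bot, ?_, fun a C₁ haC₁ hC₁ => ?_⟩
  · intro hG0
    have hG0' : red₂ G = 0 := by simpa using hG0
    have hmem : red₂ (toUnr₂ 2 J C₀) ∈ Ideal.span {red₂ G} := hGC ▸ Ideal.mem_span_singleton_self _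
    rw [hG0', Ideal.span_singleton_eq_bot.mpr rfl, Ideal.mem_bot] at hmem
    exact hC' hmem
  · rw [bot_sup_eq, hGC]
    rcases Nat.eq_zero_or_pos a with rfl | ha
    · rw [pow_zero, one_mul] at haC₁
      rw [← haC₁]; exact Ideal.mem_span_singleton_self _
    · exfalso
      apply hC'
      have hred2 : red₂ (2 : A₂) = 0 := by
        have h := Summit.BirchSwinnertonDyer.BirchSwinnertonDyer.Theorems.TwoAdicBDPPrimePinning.map_map_residue_natCast_prime (p := 2)
        rw [Nat.cast_ofNat] at h
        exact h
      rw [haC₁, map_mul, map_pow, hred2, zero_pow ha.ne', zero_mul]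

/-- `Rres → ACPIN` on the habitat. -/
theorem acFibrePinningAtTwo_of_residualEqualityForallAtTwo :
    TwoVariableResidualEqualityForallAtTwo → AcFibrePinningAtTwo :=
  fun h W _ _ hCM hGO hβ K _ _ hK => greenbergAcFibrePinningAt_of_residualEqualityForall W K (h W hCM hGO hβ K hK)

/-- The v4.1 research set still closes O2 under the ACPIN node: `O2 ⟸ P0 ∧ PIN ∧ CONTENT ∧ U ∧ R0T ∧ Rres` via `Rres ⇒ ACPIN`. -/
theorem bdpSelmerLowerDivisibilityAtTwo_of_residual_via_acPin :
    XGr₂CharIdealPrincipalAtTwo → PrimePinning₂ → TwoContent₂ → TwoVariableUpperInclusionRatAtTwo →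
      TwoVariableFrameTorsionAtTwo → TwoVariableResidualEqualityForallAtTwo → O2Goal :=
  fun hP hPin hCt hU h0 hres => bdpSelmerLowerDivisibilityAtTwo_of_acPieces hP hPin hCt hU h0
    (acFibrePinningAtTwo_of_residualEqualityForallAtTwo hres)

/-! ## §6 (k2) ACPIN ⟸ a ONE-LINE reading through ANY surjective residual line functional (seat 2 g3/g4's seam; PROVED, unregistered)

Seat 2's `anticyclotomic_line_reading_two` (ACLR) reads (N) and (Λ) on the in-frame anticyclotomic `ℤ₂`-line through
`red₁ ∘ lineRes J a b : 𝒪_{ℂ₂}⟦T₁,T₂⟧ → 𝔽̄₂⟦T⟧`; seat 2 g4's `residual_selmer_control_two` re-types the Λ-half of that reading in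
`λ`-currency (`dvd_iff_order_le`: in `𝔽̄₂⟦T⟧`, for `g ≠ 0`, `g ∣ c ↔ ord_T g ≤ ord_T c`).  The sub-node below is the
COMPOSITION-LEVEL content of both, against THIS file's frame: for ANY surjective ring map `φ : 𝔽̄₂⟦T₁,T₂⟧ → 𝔽̄₂⟦T⟧` (its kernel
is then a prime — `𝔽̄₂⟦T⟧` is a domain), N_φ `φ(red G) ≠ 0` and λ_φ `ord_T φ(red G) ≤ ord_T φ(red C₁)` give `FibrePinned G C'`
with `𝔓 := ker φ`.  The INTENDED `φ` is the residual anticyclotomic line functional of the pair (seat 2's `lineRes J κ_ac(γ₁)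
κ_ac(γ₂)` reduced); naming it needs the anticyclotomic `ℤ₂`-extension as DATA relative to the pair — not typed here, so N_ac
and Λ_ac stay coupled by `∃ φ` (ACLR♮ below) and ACPIN remains the registered stub. -/

section LineReading

variable {k : Type*} [Field k]

/-- In `k⟦T⟧` (`k` a field) a non-zero `g` divides every `c` with `ord_T g ≤ ord_T c` (seat 2 g4's `dvd_of_order_le`,
re-proved here because Cruxes files are not importable modules). -/
theorem dvd_of_order_le' {g c : PowerSeries k} (hg : g ≠ 0) (h : g.order ≤ c.order) : g ∣ c := by
  by_cases hc0 : c = 0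
  · simp [hc0]
  have hcfin : c.order ≠ ⊤ := fun htop => hc0 (PowerSeries.order_eq_top.mp htop)
  have hle : g.order.toNat ≤ c.order.toNat := ENat.toNat_le_toNat h hcfin
  obtain ⟨u, hu⟩ := PowerSeries.isUnit_divided_by_X_pow_order hg
  have h1 : g ∣ (PowerSeries.X : PowerSeries k) ^ g.order.toNat := by
    refine ⟨↑u⁻¹, ?_⟩
    calc (PowerSeries.X : PowerSeries k) ^ g.order.toNat
        = PowerSeries.X ^ g.order.toNat * (g.divXPowOrder * ↑u⁻¹) := by
          rw [← hu, Units.mul_inv, mul_one]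
      _ = (PowerSeries.X ^ g.order.toNat * g.divXPowOrder) * ↑u⁻¹ := by ring
      _ = g * ↑u⁻¹ := by rw [PowerSeries.X_pow_order_mul_divXPowOrder]
  exact h1.trans ((pow_dvd_pow _ hle).trans PowerSeries.X_pow_order_dvd)

end LineReading

/-- **FibrePinned from a one-line reading** (kernel): `φ : 𝔽̄₂⟦T₁,T₂⟧ →+* 𝔽̄₂⟦T⟧` surjective, N_φ `φ (red₂ G) ≠ 0`, λ_φ
`ord (φ (red₂ G)) ≤ ord (φ (red₂ C₁))` for every primitive part `C₁` of `C'` ⟹ `FibrePinned G C'` (with `𝔓 = ker φ`). -/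
theorem fibrePinned_of_lineReading (G C' : A₂) (φ : Ω₂ →+* Ω₁) (hφ : Function.Surjective φ)
    (hN : φ (red₂ G) ≠ 0)
    (hΛ : ∀ (a : ℕ) (C₁ : A₂), C' = (2 : A₂) ^ a * C₁ → red₂ C₁ ≠ 0 → (φ (red₂ G)).order ≤ (φ (red₂ C₁)).order) :
    FibrePinned G C' := by
  refine ⟨RingHom.ker φ, RingHom.ker_isPrime φ, by rwa [RingHom.mem_ker], fun a C₁ haC₁ hC₁ => ?_⟩
  obtain ⟨q, hq⟩ := dvd_of_order_le' hN (hΛ a C₁ haC₁ hC₁)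
  obtain ⟨Q, rfl⟩ := hφ q
  have hker : red₂ C₁ - red₂ G * Q ∈ RingHom.ker φ := by
    rw [RingHom.mem_ker, map_sub, map_mul, hq, sub_self]
  have : red₂ C₁ = (red₂ C₁ - red₂ G * Q) + red₂ G * Q := by ring
  rw [this]
  exact Submodule.add_mem_sup hker (Ideal.mem_span_singleton'.mpr ⟨Q, by ring⟩)

/-- **ACLR♮ at `(E,K)`** — the one-line reading in `∃φ`-form: for every admissible frame datum, `J`, generator `C₀`, SOME surjective
residual line functional `φ` carries N_φ (`μ = 0` of `G` on that residual line) and λ_φ (`λ(G|_φ) ≤ λ(C₁|_φ)` for the primitive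
part of `J C₀`).  Intended `φ` = the in-frame anticyclotomic line; typed WEAKER (any line will do). -/
def GreenbergAcLineReadingAt (W : WeierstrassCurve ℚ) [W.IsElliptic] [W.IsGloballyMinimal]
    (K : Type) [Field K] [NumberField K] : Prop :=
  ∀ [IsCMField K] (ι : PadicAlgCl 2 ≃+* ℂ) (v vbar : HeightOneSpectrum (𝓞 K)) (κ₁ κ₂ : ZpExtension K 2)
    (γ₁ γ₂ : absoluteGaloisGroup K) [Fact (ZpExtension.IsTopGeneratorPair κ₁ κ₂ γ₁ γ₂)]
    [NeZero (W.conductorNorm ℤ)] (f : CuspForm (Gamma0 (W.conductorNorm ℤ)) 2),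
    ModularForms.IsNewformOf W f → ∀ [NeZero (NumberField.discr K).natAbs],
    ((2 : ℕ) : 𝓞 K) ∈ v.asIdeal → ((2 : ℕ) : 𝓞 K) ∈ vbar.asIdeal → vbar ≠ v →
    (∀ (w : InfinitePlace K) (k : 𝓞 K), k ∈ v.asIdeal ↔ ‖ι.symm (w.embedding (k : K))‖ < 1) →
    ∀ (Ω δ : ℂ) (Ωp : (unrIntegers 2)ˣ) (LK G : A₂),
      Ω ≠ 0 → (δ ^ 2 = (NumberField.discr K : ℂ) ∨ δ ^ 2 = -(NumberField.discr K : ℂ)) →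
      IsKatzMeasure₂ ι v vbar ∅ κ₁ κ₂ γ₁⁻¹ γ₂⁻¹ 1 Ω δ ((Ωp : unrIntegers 2) : ℂ_[2]) LK →
      IsGreenbergLFunctionFree₂ ι v vbar κ₁ κ₂ γ₁⁻¹ γ₂⁻¹ f (NumberField.discr K).natAbs
        (NumberField.classNumber K) LK G →
      ∀ J : ℤ_[2] →+* PadicComplexInt 2,
        (∀ x : ℤ_[2], ((J x : PadicComplexInt 2) : ℂ_[2]) = ((x : ℚ_[2]) : ℂ_[2])) →
        ∀ C₀ : IwasawaAlgebra₂ 2,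
          WeierstrassCurve.XGr₂.charIdeal (W.baseChange K) 2 κ₁ κ₂ vbar γ₁ γ₂ = Ideal.span {C₀} →
          ∃ φ : Ω₂ →+* Ω₁, Function.Surjective φ ∧ φ (red₂ G) ≠ 0 ∧
            ∀ (a : ℕ) (C₁ : A₂), toUnr₂ 2 J C₀ = (2 : A₂) ^ a * C₁ → red₂ C₁ ≠ 0 →
              (φ (red₂ G)).order ≤ (φ (red₂ C₁)).order

/-- ACLR♮ on the habitat (β) — N_ac ∧ λ_ac read through one residual line functional per datum.  Unregistered (card §v6). -/
def AcLineReadingAtTwo : Prop :=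
  ∀ (W : WeierstrassCurve ℚ) [W.IsElliptic] [W.IsGloballyMinimal],
    ¬ W.HasCM → GoodOrd W 2 → ¬ W.HasIrreducibleModPGaloisRep 2 →
    ∀ (K : Type) [Field K] [NumberField K],
      (IsImaginaryQuadratic K ∧ SatisfiesHeegnerHypothesis (2 * W.conductorNorm ℤ) K) →
      GreenbergAcLineReadingAt W K

/-- **(k2) sub-node: ACLR♮ ⇒ ACPIN at a datum** (`fibrePinned_of_lineReading`). -/
theorem greenbergAcFibrePinningAt_of_lineReading (W : WeierstrassCurve ℚ) [W.IsElliptic] [W.IsGloballyMinimal]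
    (K : Type) [Field K] [NumberField K] (h : GreenbergAcLineReadingAt W K) : GreenbergAcFibrePinningAt W K := by
  intro _ ι v vbar κ₁ κ₂ γ₁ γ₂ _ _ f hf _ hv hvbar hne hι Ω δ Ωp LK G hΩ hδ hLK hG J hJ C₀ hC₀
  obtain ⟨φ, hφ, hN, hΛ⟩ := h ι v vbar κ₁ κ₂ γ₁ γ₂ f hf hv hvbar hne hι Ω δ Ωp LK G hΩ hδ hLK hG J hJ C₀ hC₀
  exact fibrePinned_of_lineReading G (toUnr₂ 2 J C₀) φ hφ hN hΛ

/-- **(k2) sub-node on the habitat: `ACLR♮ → ACPIN`** (`acFibrePinning_of_nac_of_lambdaAc` in the pen's wording, with N_ac and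
λ_ac coupled by the line functional). -/
theorem acFibrePinningAtTwo_of_acLineReading : AcLineReadingAtTwo → AcFibrePinningAtTwo :=
  fun h W _ _ hCM hGO hβ K _ _ hK => greenbergAcFibrePinningAt_of_lineReading W K (h W hCM hGO hβ K hK)

/-- The node through the one-line reading: `O2 ⟸ PRINT{thmII417} ∧ U ∧ R0G ∧ (TORSION ∧ RESIDUE) ∧ ACLR♮`, sorry-free. -/
theorem bdpSelmerLowerDivisibilityAtTwo_of_katzSheet_of_torsionResidue_of_lineReading
    (hdS : DeShalit1987.thmII417_exists_katzSheet) :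
    TwoVariableUpperInclusionRatAtTwo → TwoVariableGreenbergObjectAtTwo → TwoVariableTorsionResidueAtTwo →
      AcLineReadingAtTwo → O2Goal :=
  fun hU hG hT hR => bdpSelmerLowerDivisibilityAtTwo_of_katzSheet_of_torsionResidue_of_acPin hdS hU hG hT
    (acFibrePinningAtTwo_of_acLineReading hR)

end Summit.BirchSwinnertonDyer.BirchSwinnertonDyer.Cruxes.BDPSelmerLowerDivisibilityAtTwo.TwoVariableGvSqueezeTwo

end
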